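/-
Copyright: statement-level skeleton of a published paper (lit-balaban cell, Phase-2 proof seat p26 gen 47). No claims beyond
what the kernel checks below.
-/
import Mathlib
import Literature.MathematicalPhysics.QuantumFieldTheory.Balaban1983to89.B3Ineq213ZeroBackground
import Literature.MathematicalPhysics.QuantumFieldTheory.Balaban1983to89.B3Ineq215Assembly
import Literature.MathematicalPhysics.QuantumFieldTheory.Balaban1983to89.B3Prop21Uniform

/-!
# B3 — T. Bałaban, *(Higgs)₂,₃ quantum fields in a finite volume. III. Renormalization*, CMP **88** (1983) 411–445
[Balaban1983Higgs3] — pp. 424–428 [PDF 14–18]: **PROPOSITION 2.1 AT ZERO BACKGROUND FOR THE UNDECOMPOSED EXPRESSION** — the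
printed proof of Proposition 2.1 assembled end to end on the Feynman-rule evaluator of this lineage: the decomposition (2.6) of EVERY line
propagator into its scale pieces and *"E(G′) as a sum Σ_j E(G′(j))"* (multilinearity of FILE 2's `graphAmp` in the line kernels),
the resummation (2.7) over the orderings `l̃` of the lines and the index sets `J(l̃)` (r15's `B3.display27`), the first estimate (2.13)
for each ordering (FILE 21, the enumeration of the lines composed with the ordering) and the tree's PROVED (2.15) along that ordering
(gen-2's `B3Ineq215.Model.ineq215_of_orderedAlong`), summed over the `m!` orderings: a bound on `|E(G, {□(v)}, Φ_ext, A_ext)|` with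
the lines carrying the FULL zero-background kernels `Σ_{j<k} G^η_{(j)}(T_η, 0)`, by a constant that is a function of the generalized
graph alone — *"independent of ε, k"* (Proposition 1 p. 421) — FILE 22 of the Feynman-rule evaluator lineage.

statement-level skeleton of published theorems with citation tags; proofs where landed; nothing here is a claim about
the Yang–Mills mass gap

PDF held: `paper:balaban1983-higgs-2-3-quantum-fields-finite-volume` (journal page = PDF page + 410); pp. 420–421, 424–428
[PDF 10–11, 14–18] read by this seat on the text layer `~/.lit/texts/paper-balaban1983-higgs-2-3-quantum-fields-finite-volume/p0010.txt
… p0018.txt` (2026-08-25).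

CITATION HEADER (lean-in-tree rule).  lit-balaban TYPED SKELETON (HOME `run/shared/lean/pub/lit-balaban/`), PHASE 2, seat p26 gen 47
(unit `lit-balaban-p26`; free-target protocol G.5-34(d), own lane; successor brick named in `HOME/lit-balaban-p26/DESIGN-B3-evaluator.md`
§ g46 addendum 6).  ROWS **B3.Prop2.1** (Proposition 2.1 p. 424), **B3.Eq2.7** ((2.7) p. 425, `proved-existing` by r15's `B3`),
**B3.Eq2.13-2.14**, **B3.Eq2.15**, **B3.Eq2.6**, **B3.Def@420** of `HOME/lit-balaban-r15/ROWS-B3.md` (fold owner r15; this file is an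
OPTIONAL located member, cells only, zero head weight).  CONSUMES BY NAME, nothing re-declared: FILE 21 `B3Ineq213ZeroBackground`
(`abs_graphAmp_le_ineq213_zero`, `torusKer`, `torusKer_nonneg`, `KsFree`, `KvFree`, `lineConst`, `lineConst_nonneg`, `lineDim`);
r15's `B3` (`Assignment`, `Assignment.bySort`, `display27`, `OrderedAlong`); gen-2's `B3Ineq215.Model` (`Mon`, `W`, `const215`,
`mem_Mon_of_orderedAlong`, `ineq215_of_orderedAlong`); FILE 20 (`DataBounds`, `vConst`, `extraEta`, `nPhi_nonneg`, `NE_nonneg`); FILE 18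
(`torusTreeLen`, `relBox`, `baseBlock`); FILE 14 (`sigSK`, `sigVK`, `sigOK`, `Lab`); FILE 12 (`Lines`, `lineSrc`, `lineTgt`,
`modelOfGraph`, `extAt`, `uOfKind`); FILE 2 (`graphAmp`, `graphAmp_sLines_sum`, `graphAmp_vLines_sum`, `Model`, `Loc`, `opEntry`,
`bondEntry`); FILE 1 (`amp`, `oLineFactor`, `sLineFactor`, `vLineFactor`, `OutPairing`); FILE 16 `B3Ineq210ZeroHiggsTorus` (`gpieceH_eq`,
`opEntry_propagatorK_zero_pieces`, `bondEntry_vecG_zero_pieces`); p19's `B3Ineq213.LinesConnect`; the tree's `HiggsCovariance.propagatorK`,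
`HiggsFluctMeasure.vecG`; p19's `B3Prop21Uniform` (`unifConst215`, `one_sub_rpow_neg_half_pos`) and gen-2's `B3Ineq215.Cube.Kdec`, `Model.Kst`,
`Model.rho215`, `Model.Dsum_succ_pos`, `Model.bs_mem_reps_succ`, `Model.nontriv_succ_bs` (§5).

THE PRINTED TEXT (pp. 424–428, the sentences as printed on the text layer).  p. 424: *"Proposition 2.1. Let G be a connected graph
such that its each connected subgraph, with the possible exception of the subgraphs (2.4), has a positive degree. Then we define
G_ren = {G} and Proposition 1 holds in this case."* … *"Our first step in the proof of the theorem is to write the expression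
E(G, {□(v)}_{v∈G}, Φ_ext, A_ext) = E(G′, {□(v)}_{v∈G}, Φ′_ext, A_ext) as a sum obtained by decomposing all the propagators corresponding
to the lines of G′ according to the equality"* [(2.6)] *"and the similar equality for the vector field propagator. Thus we get a sum of
new expressions obtained by replacing in each line l of the graph G′ the corresponding propagator by a propagator G_{(j_l)},
0 ≦ j_l ≦ k − 1. Let us add index j_l to the line and let us denote by G′(j) the graph G′ with indices added, j = {j_l}_{l∈G′}. We can
write E(G′) as a sum Σ_j E(G′(j)). The part of this sum with indices j different can be represented in a natural way as a sum over
orderings of the lines and for fixed ordering l̃ = {l(1), …, l(m)} a sum over indices j satisfying the condition j_{l(1)} < j_{l(2)} < … <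
j_{l(m)}. This sum can be supplemented to the sum over all indices j if equalities are admitted in the above condition. Thus for each
ordering l̃ we assign some set J(l̃) of the indices j satisfying the condition"* [j_{l(1)} ≦ … ≦ j_{l(m)}] p. 425: *"in such a way that
⋃ J(l̃) is the set of all indices and the components of this union are disjoint sets. We get the equality"* [(2.7)] *"To prove
the theorem it is sufficient to prove the estimate (1.33) for the sum with fixed ordering l̃ on the right side above. This reduction is
an important, although very simple, step in the proof because an order of summations over indices j is fixed now."*; p. 426: *"G₁, G₂,
…, G_m = G′* defined as previously have positive degrees. Thus it is sufficient to prove the estimate (1.33) under this assumption."* …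
[(2.13)]; p. 427: *"where O(1) is a constant depending on n̄ only"* … *"To prove the theorem it is sufficient to prove that"* [(2.15)]
*"with O(1) depending on n̄ and δ₁ only."*; p. 428: *"For i = m we get the constant O(1) only on the right side of (2.16), hence the
proof of the theorem is finished."*; Proposition 1, pp. 420–421: *"The constant O(1) depends on α₀, n̄ … and is independent of ε, k,
the domains Ω, Ω₁, Ω₂, the vector field B̃"*.

WHY THIS FILE ∕ READING (declared).  FILE 21 proves (2.13) × (2.15) for the expression of a graph whose lines carry the scale PIECES
of ONE multi-index `j ∈ J(l̃)` for ONE enumeration (ordering) of the lines (`abs_sum_graphAmp_le_prop21_zero`: the sum over `J(l̃) = Mon`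
at the identity ordering).  Print's Proposition 2.1 is about the UNDECOMPOSED expression: every line carries `G_k = Σ_{j=0}^{k−1} G_{(j)}`
((2.6)), the expression is the sum over ALL multi-indices ((2.6) ⇒ *"E(G′) = Σ_j E(G′(j))"*, by multilinearity of the expression in the
line propagators), regrouped by (2.7) into the orderings, each ordering estimated by (2.13) + (2.15), and the `m!` orderings absorbed into
O(1).  This file does exactly that on the evaluator: §1 the multilinearity (all three line species at once, indexed by an enumeration of
FILE 12's `Lines G Po`); §2 the orderings (an enumeration composed with a permutation `σ`; connectedness and the line constants are
invariant, the generalized graph of (2.14) is listed along `σ` — `orderedModel`); §3 the assembly; §4 the identification of the summed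
free kernels `Σ_{j<k} KsFree_j`, `Σ_{j<k} KvFree_j` with the entries of the tree's zero-background propagators `G^ε_k(T_ε, 0)`
(`HiggsCovariance.propagatorK … 0 …`) and `HiggsFluctMeasure.vecG` (FILE 16: they differ by the scalar `η^d(L^kε)²` per line, `≦ 1`), and
the corollary for the expression with THOSE kernels on its lines.  The (1.18) output pairs are carried, as in FILE 21, as lines of the
generalized graph with supplied dimensions `a_o`, constants `C_o` and a supplied scale decomposition `KoT` dominated in the torus shape
(§3 `…_pairTop`: the undecomposed (1.18) kernel put at the top scale index `k − 1`, where alone a hypothesis is asked).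
PARALLEL IN THE TREE (declared, nothing re-declared): p19's `B3Prop21Model` performs the SAME assembly — (2.7) with `Assignment.bySort`,
(2.13) termwise, (2.15) along each ordering, the sum over the `m!` orderings with the constant `Σ_σ const215(G along σ)` — for p19's
ABSTRACT majorant class `B3Ineq213.Amp` over `Counts` (`Etot_eq_sum_E`, `bound133_ordering`, `bound133_total`), where the total amplitude
is a position sum by definition; here the object is FILE 2's signed evaluator `graphAmp` on p18's graphs, for which *"E(G′) = Σ_j
E(G′(j))"* is a theorem (§1) and the hypotheses of (2.13) are the ones FILE 21 discharged; p19's uniform constant `unifConst215` of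
`B3Prop21Uniform` is REUSED (§5 re-proves its three lemmas for a general model of gen-2's class instead of a `Counts` datum).

WHAT IS TYPED ∕ PROVED (definitions with bodies + theorems; no `Prop` fact, no `sorry`; standard axioms).  §1 `amp_oLines_sum`,
`graphAmp_oLines_sum` ((2.7) on the evaluator for the output pairs, as FILE 1 ∕ 2 did for scalar and vector lines), **`graphAmp_lines_sum`**
(all lines at once: `E(Σ_t K_t on every line) = Σ_{j : Fin m → T} E(K_{j_l} on line l)` for an enumeration `eL` of the lines),
`amp_sLines_smul` ∕ `amp_vLines_smul` ∕ `graphAmp_sLines_smul` ∕ `graphAmp_vLines_smul` (homogeneity in the line kernels); §2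
`linesConnect_perm`, `orderedModel` (+ `orderedModel_one`), `PosDegAlong` (print's hypothesis *"G₁, …, G_m have positive degrees"* for
every ordering, in gen-2's currency); §3 **`abs_sum_graphAmp_le_prop21_zero_allIndices`** (the sum over ALL multi-indices `j : lines →
{0, …, k−1}` of the scale-decomposed expressions: `≦ (Π_l C_l)·(|e|^{d_v}|λ|^{d_s}e^{−δ₀d_T({B^k(y_v)})}Π_v N²vConst_v Π_v N^ext_v)·Σ_σ
const215(σ)`), **`abs_graphAmp_le_prop21_zero`** (THE UNDECOMPOSED EXPRESSION: lines carrying `Σ_{j<k} KsFree_j`, `Σ_{j<k} KvFree_j`,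
`Σ_{j<k} KoT_j` — same bound), `abs_graphAmp_le_prop21_zero_pairTop` (the (1.18) kernel undecomposed, hypothesis at scale `k − 1` only); §4
`sum_KsFree_eq`, `sum_KvFree_eq` ((2.6) in the evaluator's currency: `Σ_{j<k} KsFree_j = (η^d(L^kε)²)^{−1}·opEntry (G^ε_k(T_ε,0))`, the same
for bonds and `vecG`), **`abs_graphAmp_model_le_prop21_zero`** (the expression with the tree's zero-background propagators on every
scalar and vector line obeys the same bound); §5 `half_le_D_of_halfInt`, `half_le_Dsum_succ_halfInt`, `const215_le_unifConst215_halfInt` (p19's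
uniform-constant lemmas `half_le_D_of_pos` ∕ `half_le_Dsum_succ` ∕ `const215_le_unifConst215`, there for `Counts`, here for ANY model of gen-2's class
with half-integral `e_v`, `a_l`), `lineDim_halfInt`, `sum_const215_orderedModel_le` (`Σ_σ const215(σ) ≦ m!·unifConst215(d, L, m, 2δ₀)`),
**`abs_graphAmp_le_prop21_zero_unif`** (the bound with the constant `m!·unifConst215(d, L, m, 2δ₀)` — a function of `d`, `L`, `m`, `δ₀` only);
§6 (v1.1) `abs_pairKernel_le_torusKer_top`, `abs_sum2_sigOK_pairKernel_le_top` (FILE 2's (1.18) kernel `pairKernel a` = `−a·δ` at a common block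
point MEETS the top-scale hypothesis of `…_pairTop`: two fine sites of one `k`-block are at torus distance `≦ L^k − 1`, constant `|a|·e^{2δ₀L}·L^{a_o}`),
**`abs_graphAmp_le_prop21_zero_pair118`** (the output pairs carrying `pairKernel (κ_o l)` — print's `−a_k`, or `−½a_k` — with NO hypothesis on them).
HONEST SCOPE.  (a) Everything of FILE 21's HONEST SCOPE stands: zero background only (`B̃ = 0`), tori of p14's sub-family, `L` odd `> 1`,
`1 ≦ k ≦ K`, `L^kε ≦ 1`, graphs with `isAveragingVertex (kind v) = false` at every vertex ((1.14) ∕ (1.15) excluded — their A′-legs need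
(2.12)), `n̄ ≧ 1`; the external contractions, the data sup norms, the block configuration and connectedness are hypotheses as there.
(b) The (1.18) output pairs are lines of the generalized graph with SUPPLIED dimensions `a_o`, constants `C_o` and a supplied scale family
`KoT` dominated in the torus shape (print counts a (1.18) pairing as an identification at `y`, not as a line — `DESIGN-B3-evaluator.md`
§ g46 addendum 4; a consumer without output pairs has `Po.Line` empty and these data are vacuous); §6 (v1.1) discharges this for the
(1.18) kernel itself (`pairKernel`, put at the top scale index): only the dimensions `a_o` remain the consumer's choice (they enter only
the degree bookkeeping of the generalized graph, `PosDegAlong`, and the constants `C_o`).  (c) THE DEGREE HYPOTHESIS is taken in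
gen-2's currency FOR EVERY ORDERING (`PosDegAlong`: along every listing `σ` of the lines every nontrivial component of every `G_i` has
`D > 0`); print's graph-level hypothesis (*"each connected subgraph … has a positive degree"*, r15's `B3Prop1.PosSubgraphsExcept24`)
implies it for every ordering, but that bridge — and the exception (2.4) with the integration by parts (2.8) ∕ (2.9) — is NOT formalized
here (p19's `B3Prop21Instance.hpos_of_posSubgraphs` READS r15's `PosSubgraphsExcept24` on the components of the ordered models of a
`Counts` datum — the same currency as `PosDegAlong` — and p19's `B3Prop21Except24*` files treat (2.4) for that carrier; the dictionary
between `modelOfGraph`'s component degrees and the degree (2.1)–(2.3) of the subgraphs of p18's `Graph` is successor work).  (d) The constant is `Σ_{σ ∈ S_m} const215(σ)` (print: the `m!` orderings absorbed into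
O(1), *"depending on n̄ only"*): a function of the generalized graph (`d`, `L`, `δ₀`, `e_v`, `a_l`, the incidences) — independent of `ε`,
`k`, `K`, the volume, `N`, the scale indices, the cubes and the data; §5 majorizes it by `m!·unifConst215(d, L, m, 2δ₀)` (p19's constant)
when the supplied output-pair dimensions `a_o` are half-integers (the η-powers `extraEta` and the scalar ∕ vector line dimensions are
integers) — the dependence on the graph is then through its number of lines `m` only (print bounds `m` by a function of `n̄`, p. 414: *"The
maximal number of vertices depends in a simple way on n̄"* — not formalized); the displayed prefactor carries `Π_l C_l` and `Π_v N²vConst_v`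
as in FILE 21 (f).  (e) §4's identification is
entrywise ((2.6) of record, FILE 16); the per-line scalar `η^d(L^kε)²` between print's kernels (w.r.t. `η^d`-weighted sums, unit-lattice
normalization (I.2.22)) and the model's operator entries ((I.2.20)) is `≦ 1` and is simply dropped in the corollary — the `(L^kε)`-power
bookkeeping between running couplings and norms ((1.29)–(1.30); FILE 20 (b)) is not reproduced.  (f) Nothing new is proved about (2.10),
(2.13), (2.15): this file is bookkeeping over FILE 21, r15's (2.7) and gen-2's (2.15).  Unit `lit-balaban-p26` gen 47
(literature-prover-lit-balaban-p26-g47-0), HOME `run/shared/lean/pub/lit-balaban/`, 2026-08-25.  v1.1 (same seat, same day): §6 appended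
(code-level append-only; one local `open`), header sentences for §6 added; §1–§5 byte-identical to v1.0.
-/

open Finset
open scoped BigOperators

namespace Literature.MathematicalPhysics.QuantumFieldTheory.Balaban1983to89.B3Prop21ZeroBackground

open Literature.MathematicalPhysics.QuantumFieldTheory.Balaban1983to89.B3Cor23Concrete (Graph)
open Literature.MathematicalPhysics.QuantumFieldTheory.Balaban1983to89.B3GraphAmplitude
open Literature.MathematicalPhysics.QuantumFieldTheory.Balaban1983to89.B3GraphAmplitudeRules
open Literature.MathematicalPhysics.QuantumFieldTheory.Balaban1983to89.B3GraphAmplitudePositionForm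
open Literature.MathematicalPhysics.QuantumFieldTheory.Balaban1983to89.B3GraphAmplitudeSignedPositionForm
open Literature.MathematicalPhysics.QuantumFieldTheory.Balaban1983to89.B3Ineq213TorusBlocks
open Literature.MathematicalPhysics.QuantumFieldTheory.Balaban1983to89.B3Ineq213TorusBlocksSigned
open Literature.MathematicalPhysics.QuantumFieldTheory.Balaban1983to89.B3Ineq213VertexBounds
open Literature.MathematicalPhysics.QuantumFieldTheory.Balaban1983to89.B3Ineq213ZeroBackground
open Literature.MathematicalPhysics.QuantumFieldTheory.Balaban1983to89.B3Ineq213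
open Literature.MathematicalPhysics.QuantumFieldTheory.Balaban1983to89.B3Prop1 (VertexKind)
open Literature.MathematicalPhysics.QuantumFieldTheory.Balaban1983to89.HiggsAveraging (blockK)
open Literature.MathematicalPhysics.QuantumFieldTheory.Balaban1983to89.HiggsLattice (ChargeData)
open Literature.MathematicalPhysics.QuantumFieldTheory.Balaban1983to89.HiggsCovariance (propagatorK)
open Literature.MathematicalPhysics.QuantumFieldTheory.Balaban1983to89.B1Eq211ZeroFieldTorus (Shape)
open Literature.MathematicalPhysics.QuantumFieldTheory.Balaban1983to89.B1Eq211ZeroFieldTorusLevels (setupAt)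
open Literature.MathematicalPhysics.QuantumFieldTheory.Balaban1983to89.B3Ineq210ZeroHiggsTorus (gpieceH gpieceH_eq pieceH
  opEntry_propagatorK_zero_pieces bondEntry_vecG_zero_pieces)

noncomputable section

/-! ## §1 (2.6) ⇒ "E(G′) = Σ_j E(G′(j))": multilinearity of the evaluator in the line kernels, all three species at once -/

section Decomposition

variable {nbar : ℕ} {G : Graph nbar} {SF VF OF : Type*} {IS IV IO : Type*} [Fintype IS] [Fintype IV] [Fintype IO]

/-- kernel: a triple sum of terms each of which is a sum over a fourth index is the quadruple sum with the fourth index outermost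
(FILE 1's private kernel lemma, repeated). [folklore] -/
private theorem sum3_of_sum' {ι κ μ τ : Type*} [Fintype ι] [Fintype κ] [Fintype μ] [Fintype τ] (f : ι → κ → μ → ℝ)
    (g : τ → ι → κ → μ → ℝ) (h : ∀ a b c, f a b c = ∑ t, g t a b c) :
    ∑ a, ∑ b, ∑ c, f a b c = ∑ t, ∑ a, ∑ b, ∑ c, g t a b c := by
  simp only [h]
  have h1 : ∀ a b, ∑ c, ∑ t, g t a b c = ∑ t, ∑ c, g t a b c := fun a b => sum_comm
  simp only [h1]
  have h2 : ∀ a, ∑ b, ∑ t, ∑ c, g t a b c = ∑ t, ∑ b, ∑ c, g t a b c := fun a => sum_comm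
  simp only [h2]
  exact sum_comm

/-- **(2.7) pp. 424–425 ON THE EVALUATOR, output pairs**: if the kernel of every (1.18) output pair is decomposed as a finite sum of
pieces, `Ko l = Σ_{t∈T} K l t`, then the expression is the sum over the assignments of a piece to every output pair (the same bookkeeping
as FILE 1's `amp_sLines_sum` ∕ `amp_vLines_sum` for the scalar and vector lines). [cite: Balaban1983Higgs3, (2.7) p.425]
[cite: Balaban1983Higgs3, (1.18) p.415] -/
theorem amp_oLines_sum {T : Type*} [Fintype T] (V : Rules G SF VF OF) (bS : IS → SF) (bV : IV → VF) (bO : IO → OF)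
    (Po : OutPairing G) (Ks : SLine G → IS → IS → ℝ) (Kv : VLine G → IV → IV → ℝ) (K : Po.Line oRank → T → IO → IO → ℝ)
    (Φ : (ExtSLeg G → IS) → ℝ) (A : (ExtVLeg G → IV) → ℝ) (Ψ : (Po.Ext → IO) → ℝ) :
    amp V bS bV bO Po Ks Kv (fun l p q => ∑ t, K l t p q) Φ A Ψ =
      ∑ j : Po.Line oRank → T, amp V bS bV bO Po Ks Kv (fun l => K l (j l)) Φ A Ψ := by
  unfold amp
  refine sum3_of_sum' _ _ fun α β ο => ?_
  have ho : oLineFactor Po (fun l p q => ∑ t, K l t p q) ο = ∑ j : Po.Line oRank → T, oLineFactor Po (fun l => K l (j l)) ο := by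
    unfold oLineFactor
    exact Fintype.prod_sum fun l t => K l t (ο l.1) (ο (Po.mate l.1))
  rw [ho, mul_sum, mul_sum]

/-- **E(G) is HOMOGENEOUS in each scalar line kernel**: multiplying the kernel of every scalar line `l` by a scalar `c_l` multiplies
the expression by `Π_l c_l` (the expression is multilinear in the line propagators — the structure behind *"We can write E(G′) as a sum
Σ_j E(G′(j))"*, p. 424). [cite: Balaban1983Higgs3, (2.7) p.425] [cite: Balaban1983Higgs3, p.414] -/
theorem amp_sLines_smul (V : Rules G SF VF OF) (bS : IS → SF) (bV : IV → VF) (bO : IO → OF) (Po : OutPairing G)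
    (c : SLine G → ℝ) (Ks : SLine G → IS → IS → ℝ) (Kv : VLine G → IV → IV → ℝ) (Ko : Po.Line oRank → IO → IO → ℝ)
    (Φ : (ExtSLeg G → IS) → ℝ) (A : (ExtVLeg G → IV) → ℝ) (Ψ : (Po.Ext → IO) → ℝ) :
    amp V bS bV bO Po (fun l p q => c l * Ks l p q) Kv Ko Φ A Ψ = (∏ l, c l) * amp V bS bV bO Po Ks Kv Ko Φ A Ψ := by
  unfold amp
  simp only [Finset.mul_sum]
  refine Finset.sum_congr rfl fun α _ => Finset.sum_congr rfl fun β _ => Finset.sum_congr rfl fun ο _ => ?_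
  have hs : sLineFactor (fun l p q => c l * Ks l p q) α = (∏ l, c l) * sLineFactor Ks α := by
    unfold sLineFactor
    exact Finset.prod_mul_distrib
  rw [hs]
  ring

/-- E(G) is homogeneous in each vector line kernel (*"and the similar equality for the vector field propagator"*).
[cite: Balaban1983Higgs3, (2.7) p.425] [cite: Balaban1983Higgs3, p.414] -/
theorem amp_vLines_smul (V : Rules G SF VF OF) (bS : IS → SF) (bV : IV → VF) (bO : IO → OF) (Po : OutPairing G)
    (c : VLine G → ℝ) (Ks : SLine G → IS → IS → ℝ) (Kv : VLine G → IV → IV → ℝ) (Ko : Po.Line oRank → IO → IO → ℝ)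
    (Φ : (ExtSLeg G → IS) → ℝ) (A : (ExtVLeg G → IV) → ℝ) (Ψ : (Po.Ext → IO) → ℝ) :
    amp V bS bV bO Po Ks (fun l p q => c l * Kv l p q) Ko Φ A Ψ = (∏ l, c l) * amp V bS bV bO Po Ks Kv Ko Φ A Ψ := by
  unfold amp
  simp only [Finset.mul_sum]
  refine Finset.sum_congr rfl fun α _ => Finset.sum_congr rfl fun β _ => Finset.sum_congr rfl fun ο _ => ?_
  have hv : vLineFactor (fun l p q => c l * Kv l p q) β = (∏ l, c l) * vLineFactor Kv β := by
    unfold vLineFactor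
    exact Finset.prod_mul_distrib
  rw [hv]
  ring

/-- kernel: three sums over the functions on the three summands of a sum type enumerated by `Fin m` are one sum over the functions on
`Fin m`. [folklore] -/
private theorem sum3_eq_sum_arrow {α β γ T : Type*} [Fintype α] [Fintype β] [Fintype γ] [Fintype T]
    [DecidableEq α] [DecidableEq β] [DecidableEq γ] {m : ℕ} (e : Fin m ≃ α ⊕ (β ⊕ γ))
    (g : (α → T) → (β → T) → (γ → T) → ℝ) :
    ∑ a : α → T, ∑ b : β → T, ∑ c : γ → T, g a b c =
      ∑ j : Fin m → T, g (fun x => j (e.symm (Sum.inl x))) (fun x => j (e.symm (Sum.inr (Sum.inl x))))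
        (fun x => j (e.symm (Sum.inr (Sum.inr x)))) := by
  symm
  calc ∑ j : Fin m → T, g (fun x => j (e.symm (Sum.inl x))) (fun x => j (e.symm (Sum.inr (Sum.inl x))))
        (fun x => j (e.symm (Sum.inr (Sum.inr x))))
      = ∑ j' : α ⊕ (β ⊕ γ) → T, g (fun x => j' (Sum.inl x)) (fun x => j' (Sum.inr (Sum.inl x)))
          (fun x => j' (Sum.inr (Sum.inr x))) :=
        Fintype.sum_equiv (e.arrowCongr (Equiv.refl T)) _ _ fun j => rfl
    _ = ∑ p : (α → T) × (β ⊕ γ → T), g p.1 (fun x => p.2 (Sum.inl x)) (fun x => p.2 (Sum.inr x)) :=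
        Fintype.sum_equiv (Equiv.sumArrowEquivProdArrow α (β ⊕ γ) T) _ _ fun j' => rfl
    _ = ∑ a : α → T, ∑ q : β ⊕ γ → T, g a (fun x => q (Sum.inl x)) (fun x => q (Sum.inr x)) :=
        Fintype.sum_prod_type _
    _ = ∑ a : α → T, ∑ b : β → T, ∑ c : γ → T, g a b c := by
        refine Fintype.sum_congr _ _ fun a => ?_
        calc ∑ q : β ⊕ γ → T, g a (fun x => q (Sum.inl x)) (fun x => q (Sum.inr x))
            = ∑ p : (β → T) × (γ → T), g a p.1 p.2 :=
              Fintype.sum_equiv (Equiv.sumArrowEquivProdArrow β γ T) _ _ fun q => rfl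
          _ = ∑ b : β → T, ∑ c : γ → T, g a b c := Fintype.sum_prod_type _

variable {P : HiggsLattice.Params} {N k : ℕ} [DecidableEq (HiggsLattice.PBond P 0)]

/-- (2.7) for the concrete evaluator, output pairs: decomposing the kernel of every (1.18) pair into pieces writes the expression as the
sum over the assignments of pieces to the pairs. [cite: Balaban1983Higgs3, (2.7) p.425] [cite: Balaban1983Higgs3, (1.18) p.415] -/
theorem graphAmp_oLines_sum {T : Type*} [Fintype T] (G : Graph nbar) (M : Model P N k)
    (dm2 : Fin G.nV → HiggsLattice.Site P 0 → ℝ) (loc : Fin G.nV → Loc P k) (Po : OutPairing G)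
    (Ks : SLine G → HiggsLattice.Site P 0 × Fin N → HiggsLattice.Site P 0 × Fin N → ℝ)
    (Kv : VLine G → HiggsLattice.PBond P 0 → HiggsLattice.PBond P 0 → ℝ)
    (K : Po.Line oRank → T → HiggsLattice.Site P k × Fin N → HiggsLattice.Site P k × Fin N → ℝ)
    (Φ : (ExtSLeg G → HiggsLattice.Site P 0 × Fin N) → ℝ) (A : (ExtVLeg G → HiggsLattice.PBond P 0) → ℝ)
    (Ψ : (Po.Ext → HiggsLattice.Site P k × Fin N) → ℝ) :
    graphAmp G M dm2 loc Po Ks Kv (fun l p q => ∑ t, K l t p q) Φ A Ψ =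
      ∑ j : Po.Line oRank → T, graphAmp G M dm2 loc Po Ks Kv (fun l => K l (j l)) Φ A Ψ :=
  amp_oLines_sum _ _ _ _ _ _ _ _ _ _ _

/-- **(2.6) ⇒ *"We can write E(G′) as a sum Σ_j E(G′(j))"* (p. 424) ON THE CONCRETE EVALUATOR, ALL LINES AT ONCE**: if every
scalar line, every vector line and every output pair carries a kernel decomposed into pieces indexed by `T` (*"decomposing all the
propagators corresponding to the lines of G′ according to the equality (2.6) and the similar equality for the vector field
propagator"*), then for any enumeration `eL` of the lines (FILE 12's `Lines G Po`) the expression is the sum over ALL multi-indices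
`j : Fin m → T` of the expressions with the piece `j_l` on line `l` (*"replacing in each line l of the graph G′ the corresponding
propagator by a propagator G_{(j_l)}"*). [cite: Balaban1983Higgs3, (2.6) p.424] [cite: Balaban1983Higgs3, (2.7) p.425] -/
theorem graphAmp_lines_sum {T : Type*} [Fintype T] (G : Graph nbar) (M : Model P N k)
    (dm2 : Fin G.nV → HiggsLattice.Site P 0 → ℝ) (loc : Fin G.nV → Loc P k) (Po : OutPairing G) {m : ℕ} (eL : Fin m ≃ Lines G Po)
    (KS : SLine G → T → HiggsLattice.Site P 0 × Fin N → HiggsLattice.Site P 0 × Fin N → ℝ)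
    (KV : VLine G → T → HiggsLattice.PBond P 0 → HiggsLattice.PBond P 0 → ℝ)
    (KO : Po.Line oRank → T → HiggsLattice.Site P k × Fin N → HiggsLattice.Site P k × Fin N → ℝ)
    (Φ : (ExtSLeg G → HiggsLattice.Site P 0 × Fin N) → ℝ) (A : (ExtVLeg G → HiggsLattice.PBond P 0) → ℝ)
    (Ψ : (Po.Ext → HiggsLattice.Site P k × Fin N) → ℝ) :
    graphAmp G M dm2 loc Po (fun l p q => ∑ t, KS l t p q) (fun l p q => ∑ t, KV l t p q) (fun l p q => ∑ t, KO l t p q) Φ A Ψ =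
      ∑ j : Fin m → T, graphAmp G M dm2 loc Po (fun l => KS l (j (eL.symm (Sum.inl l))))
        (fun l => KV l (j (eL.symm (Sum.inr (Sum.inl l))))) (fun l => KO l (j (eL.symm (Sum.inr (Sum.inr l))))) Φ A Ψ := by
  rw [graphAmp_sLines_sum]
  simp_rw [graphAmp_vLines_sum, graphAmp_oLines_sum]
  exact sum3_eq_sum_arrow eL fun a b c =>
    graphAmp G M dm2 loc Po (fun l => KS l (a l)) (fun l => KV l (b l)) (fun l => KO l (c l)) Φ A Ψ

/-- Homogeneity of the concrete evaluator in the scalar line kernels. [cite: Balaban1983Higgs3, (2.7) p.425] -/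
theorem graphAmp_sLines_smul (G : Graph nbar) (M : Model P N k) (dm2 : Fin G.nV → HiggsLattice.Site P 0 → ℝ)
    (loc : Fin G.nV → Loc P k) (Po : OutPairing G) (c : SLine G → ℝ)
    (Ks : SLine G → HiggsLattice.Site P 0 × Fin N → HiggsLattice.Site P 0 × Fin N → ℝ)
    (Kv : VLine G → HiggsLattice.PBond P 0 → HiggsLattice.PBond P 0 → ℝ)
    (Ko : Po.Line oRank → HiggsLattice.Site P k × Fin N → HiggsLattice.Site P k × Fin N → ℝ)
    (Φ : (ExtSLeg G → HiggsLattice.Site P 0 × Fin N) → ℝ) (A : (ExtVLeg G → HiggsLattice.PBond P 0) → ℝ)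
    (Ψ : (Po.Ext → HiggsLattice.Site P k × Fin N) → ℝ) :
    graphAmp G M dm2 loc Po (fun l p q => c l * Ks l p q) Kv Ko Φ A Ψ = (∏ l, c l) * graphAmp G M dm2 loc Po Ks Kv Ko Φ A Ψ :=
  amp_sLines_smul _ _ _ _ _ _ _ _ _ _ _ _

/-- Homogeneity of the concrete evaluator in the vector line kernels. [cite: Balaban1983Higgs3, (2.7) p.425] -/
theorem graphAmp_vLines_smul (G : Graph nbar) (M : Model P N k) (dm2 : Fin G.nV → HiggsLattice.Site P 0 → ℝ)
    (loc : Fin G.nV → Loc P k) (Po : OutPairing G) (c : VLine G → ℝ)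
    (Ks : SLine G → HiggsLattice.Site P 0 × Fin N → HiggsLattice.Site P 0 × Fin N → ℝ)
    (Kv : VLine G → HiggsLattice.PBond P 0 → HiggsLattice.PBond P 0 → ℝ)
    (Ko : Po.Line oRank → HiggsLattice.Site P k × Fin N → HiggsLattice.Site P k × Fin N → ℝ)
    (Φ : (ExtSLeg G → HiggsLattice.Site P 0 × Fin N) → ℝ) (A : (ExtVLeg G → HiggsLattice.PBond P 0) → ℝ)
    (Ψ : (Po.Ext → HiggsLattice.Site P k × Fin N) → ℝ) :
    graphAmp G M dm2 loc Po Ks (fun l p q => c l * Kv l p q) Ko Φ A Ψ = (∏ l, c l) * graphAmp G M dm2 loc Po Ks Kv Ko Φ A Ψ :=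
  amp_vLines_smul _ _ _ _ _ _ _ _ _ _ _ _

end Decomposition

/-! ## §2 Orderings of the lines: the enumeration composed with a permutation -/

section Orderings

/-- **CONNECTEDNESS DOES NOT DEPEND ON THE ORDERING**: the lines listed along any permutation `σ` connect the same vertex set
(Proposition 2.1: *"Let G be a connected graph"*; p19's `LinesConnect`). [cite: Balaban1983Higgs3, Prop. 2.1 p.424] -/
theorem linesConnect_perm {V : Type*} {m : ℕ} {src tgt : Fin m → V} (h : LinesConnect src tgt) (σ : Equiv.Perm (Fin m)) :
    LinesConnect (fun i => src (σ i)) (fun i => tgt (σ i)) := by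
  intro u w
  refine Relation.EqvGen.mono ?_ u w (h u w)
  rintro a b ⟨l, ha, hb⟩
  exact ⟨σ.symm l, by simpa using ha, by simpa using hb⟩

variable {nbar : ℕ}

/-- **THE GENERALIZED GRAPH OF (2.14) LISTED ALONG AN ORDERING `l̃ = σ`**: FILE 12 §7's `modelOfGraph` for the enumeration `eL ∘ σ` of the
lines (line `i` of the model is the line `eL (σ i)`: p. 425 *"for fixed ordering l̃ = {l(1), …, l(m)} … G₁ is formed by the line l(1) …,
G_{i+1} is built by adding to the graph G_i the line l(i+1)"*), with η-powers `e_v` and line dimensions `a_l` given as functions of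
the vertex ∕ the line. [cite: Balaban1983Higgs3, (2.7) p.425] [cite: Balaban1983Higgs3, (2.14) p.427] -/
def orderedModel (G : Graph nbar) (Po : OutPairing G) {m : ℕ} (eL : Fin m ≃ Lines G Po) (σ : Equiv.Perm (Fin m))
    (e : Fin G.nV → ℝ) (aL : Lines G Po → ℝ) (d L : ℕ) (δ₀ : ℝ) (hd : 0 < d) (hL : 2 ≤ L) (hδ : 0 < δ₀) :
    B3Ineq215.Model (Fin G.nV) m :=
  modelOfGraph G Po (σ.trans eL) e (fun i => aL (eL (σ i))) d L δ₀ hd hL hδ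

/-- At the identity ordering the ordered model is FILE 12's `modelOfGraph` for `eL` itself. [cite: Balaban1983Higgs3, (2.14) p.427] -/
theorem orderedModel_one (G : Graph nbar) (Po : OutPairing G) {m : ℕ} (eL : Fin m ≃ Lines G Po)
    (e : Fin G.nV → ℝ) (aL : Lines G Po → ℝ) (d L : ℕ) (δ₀ : ℝ) (hd : 0 < d) (hL : 2 ≤ L) (hδ : 0 < δ₀) :
    orderedModel G Po eL 1 e aL d L δ₀ hd hL hδ = modelOfGraph G Po eL e (fun i => aL (eL i)) d L δ₀ hd hL hδ := rfl

/-- **PRINT'S DEGREE HYPOTHESIS ALONG EVERY ORDERING** (p. 426: *"G₁, G₂, …, G_m = G′* defined as previously have positive degrees. Thus it is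
sufficient to prove the estimate (1.33) under this assumption"*), in gen-2's currency: for every ordering `σ` of the lines, every `i ≦ m`
and every nontrivial connected component (representative `b`) of `G_i`, the degree `D` is positive — the hypothesis of gen-2's
`ineq215_of_pos` for each ordered model. [cite: Balaban1983Higgs3, Prop. 2.1 p.424] [cite: Balaban1983Higgs3, (2.15) p.427] -/
def PosDegAlong (G : Graph nbar) (Po : OutPairing G) {m : ℕ} (eL : Fin m ≃ Lines G Po)
    (e : Fin G.nV → ℝ) (aL : Lines G Po → ℝ) (d L : ℕ) (δ₀ : ℝ) (hd : 0 < d) (hL : 2 ≤ L) (hδ : 0 < δ₀) : Prop :=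
  ∀ σ : Equiv.Perm (Fin m), ∀ i, i ≤ m →
    ∀ b ∈ (orderedModel G Po eL σ e aL d L δ₀ hd hL hδ).reps i,
      (orderedModel G Po eL σ e aL d L δ₀ hd hL hδ).Nontriv i b → 0 < (orderedModel G Po eL σ e aL d L δ₀ hd hL hδ).D i b

/-- The degree hypothesis along every ordering contains gen-2's hypothesis for each ordered model (unfolding).
[cite: Balaban1983Higgs3, (2.15) p.427] -/
theorem PosDegAlong.along {G : Graph nbar} {Po : OutPairing G} {m : ℕ} {eL : Fin m ≃ Lines G Po}
    {e : Fin G.nV → ℝ} {aL : Lines G Po → ℝ} {d L : ℕ} {δ₀ : ℝ} {hd : 0 < d} {hL : 2 ≤ L} {hδ : 0 < δ₀}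
    (h : PosDegAlong G Po eL e aL d L δ₀ hd hL hδ) (σ : Equiv.Perm (Fin m)) :
    ∀ i, i ≤ m → ∀ b ∈ (orderedModel G Po eL σ e aL d L δ₀ hd hL hδ).reps i,
      (orderedModel G Po eL σ e aL d L δ₀ hd hL hδ).Nontriv i b → 0 < (orderedModel G Po eL σ e aL d L δ₀ hd hL hδ).D i b :=
  h σ

end Orderings

/-! ## §3 Proposition 2.1 at zero background: all multi-indices, and the undecomposed expression -/

section Prop21

/-- **THE SUM OVER ALL MULTI-INDICES, BOUNDED `k`-UNIFORMLY** — (2.7) + (2.13) + (2.15): for the data of FILE 21 (a graph of p18's model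
without averaging vertices, block-localized, at zero background, with data sup norms, external contractions and a scale family `KoT`
for the (1.18) pairs dominated in the torus shape) and the degree hypothesis along every ordering, the sum over ALL multi-indices
`j : lines → {0, …, k−1}` of the scale-decomposed expressions (free pieces `G^η_{(j_l)}(T_η, 0)` on the scalar and vector lines, `KoT_{j_l}`
on the output pairs) is bounded by `(Π_l C_l)·(|e|^{d_v(G)}|λ|^{d_s(G)}·e^{−δ₀ d_T({B^k(y_v)})}·Π_v N²vConst_v·Π_v N^ext_v)·Σ_{σ∈S_m}
const215(σ)`: by (2.7) (r15's `B3.display27` for the assignment `J = bySort`) the sum is `Σ_σ Σ_{j∈J(σ)}`; each term is bounded by FILE 21's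
(2.13) for the enumeration `eL ∘ σ` (the multi-index read along `σ` is monotone: gen-2's `mem_Mon_of_orderedAlong`; connectedness and
`Π_l C_l` do not depend on the ordering), and `Σ_{j∈J(σ)} W(j read along σ) ≦ const215(σ)` is gen-2's PROVED (2.15) along `σ`
(`ineq215_of_orderedAlong`). [cite: Balaban1983Higgs3, Proposition 2.1 p.424] [cite: Balaban1983Higgs3, (2.7) p.425]
[cite: Balaban1983Higgs3, (2.13) p.426] [cite: Balaban1983Higgs3, (2.15) p.427] -/
theorem abs_sum_graphAmp_le_prop21_zero_allIndices {nbar : ℕ} (d L : ℕ) (hd : 1 ≤ d) (hL : Odd L ∧ 1 < L)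
    {aS : ℝ} (haS : 0 < aS) {mS : ℝ} (hmS : 0 ≤ mS) {aV : ℝ} (haV : 0 < aV) {mV : ℝ} (hmV : 0 ≤ mV) :
    ∃ δ₁ C₀ : ℝ, 0 < δ₁ ∧ 0 < C₀ ∧
    ∀ (P : HiggsLattice.Params) [DecidableEq (HiggsLattice.PBond P 0)] (S : Shape P), P.d = d → P.L = L →
    ∀ (k : ℕ) (hk : k ≤ P.K), 1 ≤ k → P.mesh k ≤ 1 → ∀ (hL2 : 2 ≤ P.L) (N : ℕ) (Mh : Model P N k), Mh.B = 0 →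
    ∀ (G : Graph nbar), 1 ≤ nbar → (∀ v, (G.kind v).isAveragingVertex = false) →
    ∀ (dm2 : Fin G.nV → HiggsLattice.Site P 0 → ℝ) (loc : Fin G.nV → Loc P k) (B : ∀ v, DataBounds Mh (dm2 v) (loc v))
      (Po : OutPairing G) {m : ℕ}
      (KoT : ℕ → Po.Line oRank → HiggsLattice.Site P k × Fin N → HiggsLattice.Site P k × Fin N → ℝ)
      (Φ : (ExtSLeg G → HiggsLattice.Site P 0 × Fin N) → ℝ) (A : (ExtVLeg G → HiggsLattice.PBond P 0) → ℝ)
      (Ψ : (Po.Ext → HiggsLattice.Site P k × Fin N) → ℝ)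
      (eL : Fin m ≃ Lines G Po) (δ₀ : ℝ) (hδ : 0 < δ₀), δ₀ ≤ δ₁ →
    ∀ (ao : Po.Line oRank → ℝ) (Co : Po.Line oRank → ℝ), (∀ l, 0 ≤ Co l) →
    (∀ t, t < k → ∀ (l : Po.Line oRank) (ξ₁ ξ₂ : Lab P N),
      |∑ r, ∑ r', sigOK k (G.kind l.1.1) l.1.2 ξ₁ r * sigOK k (G.kind (Po.mate l.1).1) (Po.mate l.1).2 ξ₂ r' * KoT t l r r'| ≤
        torusKer P.L k δ₀ (Co l) (ao l) t ξ₁.pos ξ₂.pos) →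
    ∀ (nS : ExtSLeg G → HiggsLattice.Site P 0 → ℝ), (∀ e x, 0 ≤ nS e x) →
    (∀ ξ : Fin G.nV → Lab P N,
      |∑ γ : ExtSLeg G → HiggsLattice.Site P 0 × Fin N, (∏ e : ExtSLeg G, sigSK Mh (G.kind e.1.1) e.1.2 (ξ e.1.1) (γ e)) * Φ γ| ≤
        ∏ e : ExtSLeg G, nS e (ξ e.1.1).pos) →
    ∀ (nV : ExtVLeg G → HiggsLattice.Site P 0 → ℝ), (∀ e x, 0 ≤ nV e x) →
    (∀ ξ : Fin G.nV → Lab P N,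
      |∑ ζ : ExtVLeg G → HiggsLattice.PBond P 0, (∏ e : ExtVLeg G, sigVK Mh (G.kind e.1.1) e.1.2 (ξ e.1.1) (ζ e)) * A ζ| ≤
        ∏ e : ExtVLeg G, nV e (ξ e.1.1).pos) →
    ∀ (nO : Po.Ext → HiggsLattice.Site P 0 → ℝ), (∀ e x, 0 ≤ nO e x) →
    (∀ ξ : Fin G.nV → Lab P N,
      |∑ ο : Po.Ext → HiggsLattice.Site P k × Fin N, (∏ e : Po.Ext, sigOK k (G.kind e.1.1) e.1.2 (ξ e.1.1) (ο e)) * Ψ ο| ≤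
        ∏ e : Po.Ext, nO e (ξ e.1.1).pos) →
    ∀ (NE : Fin G.nV → ℝ), (∀ v x, |extAt Po nS nV nO v x| ≤ NE v) →
    ∀ (y : Fin G.nV → HiggsLattice.Site P k),
      (∀ v x, x ∉ blockK k (y v) → uOfKind Mh (dm2 v) (loc v) (G.kind v) x = 0) →
    ∀ (p : HiggsLattice.Site P k) (D : ℕ), (∀ v, HiggsLattice.Site.tdist (y v) p ≤ D) → (∀ μ, 2 * D < P.halfPerDir k μ) →
    LinesConnect (fun i => lineSrc Po (eL i)) (fun i => lineTgt Po (eL i)) →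
    PosDegAlong G Po eL (fun v => ((extraEta (G.kind v) : ℤ) : ℝ)) (lineDim G Po P.d ao) P.d P.L δ₀ P.hd hL2 hδ →
    |∑ j : Fin m → Fin k, graphAmp G Mh dm2 loc Po (fun l => KsFree S hk aS mS (j (eL.symm (Sum.inl l))))
        (fun l => KvFree S hk aV mV (j (eL.symm (Sum.inr (Sum.inl l)))))
        (fun l => KoT (j (eL.symm (Sum.inr (Sum.inr l)))) l) Φ A Ψ| ≤
      (∏ i, lineConst G Po (P.mesh k) C₀ Co (eL i)) *
        (|Mh.C.e| ^ (∑ v, (G.kind v).dv) * |Mh.lamRun| ^ (∑ v, (G.kind v).ds) * Real.exp (-(δ₀ * torusTreeLen k y)) *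
          (∏ v, (N : ℝ) ^ 2 * vConst (B v) (G.kind v)) * ∏ v, NE v) *
        ∑ σ : Equiv.Perm (Fin m),
          (orderedModel G Po eL σ (fun v => ((extraEta (G.kind v) : ℤ) : ℝ)) (lineDim G Po P.d ao) P.d P.L δ₀ P.hd hL2 hδ).const215 := by
  obtain ⟨δ₁, C₀, hδ₁, hC₀, h⟩ := abs_graphAmp_le_ineq213_zero (nbar := nbar) d L hd hL haS hmS haV hmV
  refine ⟨δ₁, C₀, hδ₁, hC₀, ?_⟩
  intro P _ S hPd hPL k hk hk1 hmesh hL2 N Mh hB G hn hG dm2 loc B Po m KoT Φ A Ψ eL δ₀ hδ hδδ ao Co hCo hKo nS hnS0 hΦ nV hnV0 hA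
    nO hnO0 hΨ NE hNE y hloc p D hy hD conn hpos
  -- the multi-index expressions and the ordering-independent prefactor
  set F : (Fin m → Fin k) → ℝ := fun j => graphAmp G Mh dm2 loc Po (fun l => KsFree S hk aS mS (j (eL.symm (Sum.inl l))))
      (fun l => KvFree S hk aV mV (j (eL.symm (Sum.inr (Sum.inl l)))))
      (fun l => KoT (j (eL.symm (Sum.inr (Sum.inr l)))) l) Φ A Ψ with hF
  set pref : ℝ := (∏ i, lineConst G Po (P.mesh k) C₀ Co (eL i)) *
      (|Mh.C.e| ^ (∑ v, (G.kind v).dv) * |Mh.lamRun| ^ (∑ v, (G.kind v).ds) * Real.exp (-(δ₀ * torusTreeLen k y)) *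
        (∏ v, (N : ℝ) ^ 2 * vConst (B v) (G.kind v)) * ∏ v, NE v) with hpref
  have hprefC : 0 ≤ ∏ i, lineConst G Po (P.mesh k) C₀ Co (eL i) :=
    Finset.prod_nonneg fun i _ => lineConst_nonneg G Po (P.mesh_pos k) hC₀.le hCo (eL i)
  have hΦn : 0 ≤ ∏ v, (N : ℝ) ^ 2 * vConst (B v) (G.kind v) := Finset.prod_nonneg fun v _ => nPhi_nonneg G Mh dm2 loc B v
  have hNEn : 0 ≤ ∏ v, NE v := Finset.prod_nonneg fun v _ => NE_nonneg hNE v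
  have hpref0 : 0 ≤ pref :=
    mul_nonneg hprefC (mul_nonneg (mul_nonneg (mul_nonneg (mul_nonneg (pow_nonneg (abs_nonneg _) _) (pow_nonneg (abs_nonneg _) _))
      (Real.exp_pos _).le) hΦn) hNEn)
  -- (2.7): regroup the sum over all multi-indices by the orderings `l̃ = σ` and the index sets `J(l̃)`
  rw [B3.display27 (B3.Assignment.bySort m k)]
  refine (Finset.abs_sum_le_sum_abs _ _).trans ?_
  rw [Finset.mul_sum]
  refine Finset.sum_le_sum fun σ _ => ?_
  refine (Finset.abs_sum_le_sum_abs _ _).trans ?_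
  -- for the ordering σ: FILE 21's (2.13) with the enumeration `eL ∘ σ`, then gen-2's (2.15) along σ
  set Mσ := orderedModel G Po eL σ (fun v => ((extraEta (G.kind v) : ℤ) : ℝ)) (lineDim G Po P.d ao) P.d P.L δ₀ P.hd hL2 hδ with hMσ
  have hje : ∀ x, σ ((σ.trans eL).symm x) = eL.symm x := fun x => by simp
  have hprod : (∏ i, lineConst G Po (P.mesh k) C₀ Co ((σ.trans eL) i)) = ∏ i, lineConst G Po (P.mesh k) C₀ Co (eL i) :=
    Equiv.prod_comp σ (fun i => lineConst G Po (P.mesh k) C₀ Co (eL i))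
  have hterm : ∀ j ∈ (B3.Assignment.bySort m k).J σ,
      |F j| ≤ pref * Mσ.W 0 k (fun l => ((j (σ l) : Fin k) : ℕ)) (fun v => relBox (baseBlock p D) (y v)) := by
    intro j hj
    have hmon : (fun l => ((j (σ l) : Fin k) : ℕ)) ∈ B3Ineq215.Model.Mon m k :=
      B3Ineq215.Model.mem_Mon_of_orderedAlong ((B3.Assignment.bySort m k).ordered σ j hj)
    have hKo' : ∀ (l : Po.Line oRank) (ξ₁ ξ₂ : Lab P N),
        |∑ r, ∑ r', sigOK k (G.kind l.1.1) l.1.2 ξ₁ r * sigOK k (G.kind (Po.mate l.1).1) (Po.mate l.1).2 ξ₂ r' *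
            KoT (j (eL.symm (Sum.inr (Sum.inr l)))) l r r'| ≤
          torusKer P.L k δ₀ (Co l) (ao l) ((fun l => ((j (σ l) : Fin k) : ℕ)) ((σ.trans eL).symm (Sum.inr (Sum.inr l))))
            ξ₁.pos ξ₂.pos := by
      intro l ξ₁ ξ₂
      simp only [hje]
      exact hKo _ (j (eL.symm (Sum.inr (Sum.inr l)))).isLt l ξ₁ ξ₂
    have h1 := h P S hPd hPL k hk hk1 hmesh hL2 N Mh hB G hn hG dm2 loc B Po (fun l => KoT (j (eL.symm (Sum.inr (Sum.inr l)))) l)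
      Φ A Ψ (σ.trans eL) δ₀ hδ hδδ ao Co hCo hmon hKo' nS hnS0 hΦ nV hnV0 hA nO hnO0 hΨ NE hNE y hloc p D hy hD
      (linesConnect_perm conn σ)
    rw [hprod] at h1
    simp only [hje] at h1
    exact h1
  calc ∑ j ∈ (B3.Assignment.bySort m k).J σ, |F j|
      ≤ ∑ j ∈ (B3.Assignment.bySort m k).J σ, pref * Mσ.W 0 k (fun l => ((j (σ l) : Fin k) : ℕ)) (fun v => relBox (baseBlock p D) (y v)) :=
        Finset.sum_le_sum hterm
    _ = pref * ∑ j ∈ (B3.Assignment.bySort m k).J σ, Mσ.W 0 k (fun l => ((j (σ l) : Fin k) : ℕ)) (fun v => relBox (baseBlock p D) (y v)) := by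
        rw [Finset.mul_sum]
    _ ≤ pref * Mσ.const215 :=
        mul_le_mul_of_nonneg_left
          (Mσ.ineq215_of_orderedAlong (hpos σ) k _ σ _ ((B3.Assignment.bySort m k).ordered σ)) hpref0

/-- **PROPOSITION 2.1 AT ZERO BACKGROUND FOR THE UNDECOMPOSED EXPRESSION** — the lines carry the FULL zero-background kernels: every
scalar line `Σ_{j=0}^{k−1} G^η_{(j)}(T_η, 0) ⊗ 1_N` (`Σ_j KsFree_j`), every vector line `Σ_j KvFree_j`, every (1.18) pair `Σ_j KoT_j`
((2.6): *"G_k(Ω, B̃) = Σ_{j=0}^{k−1} G^η_{(j)}(Ω, B̃) … and the similar equality for the vector field propagator"*).  By §1 (multilinearity,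
*"We can write E(G′) as a sum Σ_j E(G′(j))"*) the expression IS the sum over all multi-indices, and the previous theorem applies:
`|E(G, {B^k(y_v)}, Φ_ext, A_ext)| ≦ (Π_l C_l)·(|e|^{d_v(G)}|λ|^{d_s(G)}·e^{−δ₀ d_T({B^k(y_v)})}·Π_v N²vConst_v·Π_v N^ext_v)·Σ_σ const215(σ)`,
the constant a function of the generalized graph alone — Proposition 1's *"O(1) … independent of ε, k"* for `G_ren = {G}`, at zero
background. [cite: Balaban1983Higgs3, Proposition 2.1 p.424] [cite: Balaban1983Higgs3, (1.33) p.420] [cite: Balaban1983Higgs3, (2.6) p.424]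
[cite: Balaban1983Higgs3, (2.7) p.425] -/
theorem abs_graphAmp_le_prop21_zero {nbar : ℕ} (d L : ℕ) (hd : 1 ≤ d) (hL : Odd L ∧ 1 < L)
    {aS : ℝ} (haS : 0 < aS) {mS : ℝ} (hmS : 0 ≤ mS) {aV : ℝ} (haV : 0 < aV) {mV : ℝ} (hmV : 0 ≤ mV) :
    ∃ δ₁ C₀ : ℝ, 0 < δ₁ ∧ 0 < C₀ ∧
    ∀ (P : HiggsLattice.Params) [DecidableEq (HiggsLattice.PBond P 0)] (S : Shape P), P.d = d → P.L = L →
    ∀ (k : ℕ) (hk : k ≤ P.K), 1 ≤ k → P.mesh k ≤ 1 → ∀ (hL2 : 2 ≤ P.L) (N : ℕ) (Mh : Model P N k), Mh.B = 0 →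
    ∀ (G : Graph nbar), 1 ≤ nbar → (∀ v, (G.kind v).isAveragingVertex = false) →
    ∀ (dm2 : Fin G.nV → HiggsLattice.Site P 0 → ℝ) (loc : Fin G.nV → Loc P k) (B : ∀ v, DataBounds Mh (dm2 v) (loc v))
      (Po : OutPairing G) {m : ℕ}
      (KoT : ℕ → Po.Line oRank → HiggsLattice.Site P k × Fin N → HiggsLattice.Site P k × Fin N → ℝ)
      (Φ : (ExtSLeg G → HiggsLattice.Site P 0 × Fin N) → ℝ) (A : (ExtVLeg G → HiggsLattice.PBond P 0) → ℝ)
      (Ψ : (Po.Ext → HiggsLattice.Site P k × Fin N) → ℝ)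
      (eL : Fin m ≃ Lines G Po) (δ₀ : ℝ) (hδ : 0 < δ₀), δ₀ ≤ δ₁ →
    ∀ (ao : Po.Line oRank → ℝ) (Co : Po.Line oRank → ℝ), (∀ l, 0 ≤ Co l) →
    (∀ t, t < k → ∀ (l : Po.Line oRank) (ξ₁ ξ₂ : Lab P N),
      |∑ r, ∑ r', sigOK k (G.kind l.1.1) l.1.2 ξ₁ r * sigOK k (G.kind (Po.mate l.1).1) (Po.mate l.1).2 ξ₂ r' * KoT t l r r'| ≤
        torusKer P.L k δ₀ (Co l) (ao l) t ξ₁.pos ξ₂.pos) →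
    ∀ (nS : ExtSLeg G → HiggsLattice.Site P 0 → ℝ), (∀ e x, 0 ≤ nS e x) →
    (∀ ξ : Fin G.nV → Lab P N,
      |∑ γ : ExtSLeg G → HiggsLattice.Site P 0 × Fin N, (∏ e : ExtSLeg G, sigSK Mh (G.kind e.1.1) e.1.2 (ξ e.1.1) (γ e)) * Φ γ| ≤
        ∏ e : ExtSLeg G, nS e (ξ e.1.1).pos) →
    ∀ (nV : ExtVLeg G → HiggsLattice.Site P 0 → ℝ), (∀ e x, 0 ≤ nV e x) →
    (∀ ξ : Fin G.nV → Lab P N,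
      |∑ ζ : ExtVLeg G → HiggsLattice.PBond P 0, (∏ e : ExtVLeg G, sigVK Mh (G.kind e.1.1) e.1.2 (ξ e.1.1) (ζ e)) * A ζ| ≤
        ∏ e : ExtVLeg G, nV e (ξ e.1.1).pos) →
    ∀ (nO : Po.Ext → HiggsLattice.Site P 0 → ℝ), (∀ e x, 0 ≤ nO e x) →
    (∀ ξ : Fin G.nV → Lab P N,
      |∑ ο : Po.Ext → HiggsLattice.Site P k × Fin N, (∏ e : Po.Ext, sigOK k (G.kind e.1.1) e.1.2 (ξ e.1.1) (ο e)) * Ψ ο| ≤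
        ∏ e : Po.Ext, nO e (ξ e.1.1).pos) →
    ∀ (NE : Fin G.nV → ℝ), (∀ v x, |extAt Po nS nV nO v x| ≤ NE v) →
    ∀ (y : Fin G.nV → HiggsLattice.Site P k),
      (∀ v x, x ∉ blockK k (y v) → uOfKind Mh (dm2 v) (loc v) (G.kind v) x = 0) →
    ∀ (p : HiggsLattice.Site P k) (D : ℕ), (∀ v, HiggsLattice.Site.tdist (y v) p ≤ D) → (∀ μ, 2 * D < P.halfPerDir k μ) →
    LinesConnect (fun i => lineSrc Po (eL i)) (fun i => lineTgt Po (eL i)) →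
    PosDegAlong G Po eL (fun v => ((extraEta (G.kind v) : ℤ) : ℝ)) (lineDim G Po P.d ao) P.d P.L δ₀ P.hd hL2 hδ →
    |graphAmp G Mh dm2 loc Po (fun _ p q => ∑ t : Fin k, KsFree S hk aS mS t p q)
        (fun _ p q => ∑ t : Fin k, KvFree S hk aV mV t p q) (fun l p q => ∑ t : Fin k, KoT t l p q) Φ A Ψ| ≤
      (∏ i, lineConst G Po (P.mesh k) C₀ Co (eL i)) *
        (|Mh.C.e| ^ (∑ v, (G.kind v).dv) * |Mh.lamRun| ^ (∑ v, (G.kind v).ds) * Real.exp (-(δ₀ * torusTreeLen k y)) *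
          (∏ v, (N : ℝ) ^ 2 * vConst (B v) (G.kind v)) * ∏ v, NE v) *
        ∑ σ : Equiv.Perm (Fin m),
          (orderedModel G Po eL σ (fun v => ((extraEta (G.kind v) : ℤ) : ℝ)) (lineDim G Po P.d ao) P.d P.L δ₀ P.hd hL2 hδ).const215 := by
  obtain ⟨δ₁, C₀, hδ₁, hC₀, h⟩ := abs_sum_graphAmp_le_prop21_zero_allIndices (nbar := nbar) d L hd hL haS hmS haV hmV
  refine ⟨δ₁, C₀, hδ₁, hC₀, ?_⟩
  intro P _ S hPd hPL k hk hk1 hmesh hL2 N Mh hB G hn hG dm2 loc B Po m KoT Φ A Ψ eL δ₀ hδ hδδ ao Co hCo hKo nS hnS0 hΦ nV hnV0 hA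
    nO hnO0 hΨ NE hNE y hloc p D hy hD conn hpos
  rw [graphAmp_lines_sum G Mh dm2 loc Po eL (fun _ (t : Fin k) => KsFree S hk aS mS t) (fun _ (t : Fin k) => KvFree S hk aV mV t)
    (fun l (t : Fin k) => KoT t l) Φ A Ψ]
  exact h P S hPd hPL k hk hk1 hmesh hL2 N Mh hB G hn hG dm2 loc B Po KoT Φ A Ψ eL δ₀ hδ hδδ ao Co hCo hKo nS hnS0 hΦ nV hnV0 hA
    nO hnO0 hΨ NE hNE y hloc p D hy hD conn hpos

/-- **THE SAME WITH THE (1.18) KERNEL UNDECOMPOSED, PUT AT THE TOP SCALE INDEX** — the (1.18) pairing `−a_k·δ` of two outputs at a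
common block point is not a propagator and has no scale decomposition; taking `KoT_t := [t = k − 1]·Ko` in the previous theorem, the
output pairs carry `Ko` itself and the only hypothesis asked of `Ko` is the torus-shape domination AT SCALE INDEX `k − 1` (`L^{k−1}η =
L^{−1}`: `|Σ_{r,r′} sig·sig·Ko_l(r, r′)| ≦ C_o(l)·L^{−a_o(l)}·exp[−2δ₀L·η|x − x′|_T]`; that the (1.18) kernel `−a_k·δ` at a common block
point meets it is the consumer's (1.18) input, NOT proved here — `DESIGN-B3-evaluator.md` § g46 addendum 4).
[cite: Balaban1983Higgs3, Proposition 2.1 p.424] [cite: Balaban1983Higgs3, (1.18) p.415] [cite: Balaban1983Higgs3, (2.7) p.425] -/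
theorem abs_graphAmp_le_prop21_zero_pairTop {nbar : ℕ} (d L : ℕ) (hd : 1 ≤ d) (hL : Odd L ∧ 1 < L)
    {aS : ℝ} (haS : 0 < aS) {mS : ℝ} (hmS : 0 ≤ mS) {aV : ℝ} (haV : 0 < aV) {mV : ℝ} (hmV : 0 ≤ mV) :
    ∃ δ₁ C₀ : ℝ, 0 < δ₁ ∧ 0 < C₀ ∧
    ∀ (P : HiggsLattice.Params) [DecidableEq (HiggsLattice.PBond P 0)] (S : Shape P), P.d = d → P.L = L →
    ∀ (k : ℕ) (hk : k ≤ P.K), 1 ≤ k → P.mesh k ≤ 1 → ∀ (hL2 : 2 ≤ P.L) (N : ℕ) (Mh : Model P N k), Mh.B = 0 →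
    ∀ (G : Graph nbar), 1 ≤ nbar → (∀ v, (G.kind v).isAveragingVertex = false) →
    ∀ (dm2 : Fin G.nV → HiggsLattice.Site P 0 → ℝ) (loc : Fin G.nV → Loc P k) (B : ∀ v, DataBounds Mh (dm2 v) (loc v))
      (Po : OutPairing G) {m : ℕ}
      (Ko : Po.Line oRank → HiggsLattice.Site P k × Fin N → HiggsLattice.Site P k × Fin N → ℝ)
      (Φ : (ExtSLeg G → HiggsLattice.Site P 0 × Fin N) → ℝ) (A : (ExtVLeg G → HiggsLattice.PBond P 0) → ℝ)
      (Ψ : (Po.Ext → HiggsLattice.Site P k × Fin N) → ℝ)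
      (eL : Fin m ≃ Lines G Po) (δ₀ : ℝ) (hδ : 0 < δ₀), δ₀ ≤ δ₁ →
    ∀ (ao : Po.Line oRank → ℝ) (Co : Po.Line oRank → ℝ), (∀ l, 0 ≤ Co l) →
    (∀ (l : Po.Line oRank) (ξ₁ ξ₂ : Lab P N),
      |∑ r, ∑ r', sigOK k (G.kind l.1.1) l.1.2 ξ₁ r * sigOK k (G.kind (Po.mate l.1).1) (Po.mate l.1).2 ξ₂ r' * Ko l r r'| ≤
        torusKer P.L k δ₀ (Co l) (ao l) (k - 1) ξ₁.pos ξ₂.pos) →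
    ∀ (nS : ExtSLeg G → HiggsLattice.Site P 0 → ℝ), (∀ e x, 0 ≤ nS e x) →
    (∀ ξ : Fin G.nV → Lab P N,
      |∑ γ : ExtSLeg G → HiggsLattice.Site P 0 × Fin N, (∏ e : ExtSLeg G, sigSK Mh (G.kind e.1.1) e.1.2 (ξ e.1.1) (γ e)) * Φ γ| ≤
        ∏ e : ExtSLeg G, nS e (ξ e.1.1).pos) →
    ∀ (nV : ExtVLeg G → HiggsLattice.Site P 0 → ℝ), (∀ e x, 0 ≤ nV e x) →
    (∀ ξ : Fin G.nV → Lab P N,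
      |∑ ζ : ExtVLeg G → HiggsLattice.PBond P 0, (∏ e : ExtVLeg G, sigVK Mh (G.kind e.1.1) e.1.2 (ξ e.1.1) (ζ e)) * A ζ| ≤
        ∏ e : ExtVLeg G, nV e (ξ e.1.1).pos) →
    ∀ (nO : Po.Ext → HiggsLattice.Site P 0 → ℝ), (∀ e x, 0 ≤ nO e x) →
    (∀ ξ : Fin G.nV → Lab P N,
      |∑ ο : Po.Ext → HiggsLattice.Site P k × Fin N, (∏ e : Po.Ext, sigOK k (G.kind e.1.1) e.1.2 (ξ e.1.1) (ο e)) * Ψ ο| ≤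
        ∏ e : Po.Ext, nO e (ξ e.1.1).pos) →
    ∀ (NE : Fin G.nV → ℝ), (∀ v x, |extAt Po nS nV nO v x| ≤ NE v) →
    ∀ (y : Fin G.nV → HiggsLattice.Site P k),
      (∀ v x, x ∉ blockK k (y v) → uOfKind Mh (dm2 v) (loc v) (G.kind v) x = 0) →
    ∀ (p : HiggsLattice.Site P k) (D : ℕ), (∀ v, HiggsLattice.Site.tdist (y v) p ≤ D) → (∀ μ, 2 * D < P.halfPerDir k μ) →
    LinesConnect (fun i => lineSrc Po (eL i)) (fun i => lineTgt Po (eL i)) →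
    PosDegAlong G Po eL (fun v => ((extraEta (G.kind v) : ℤ) : ℝ)) (lineDim G Po P.d ao) P.d P.L δ₀ P.hd hL2 hδ →
    |graphAmp G Mh dm2 loc Po (fun _ p q => ∑ t : Fin k, KsFree S hk aS mS t p q)
        (fun _ p q => ∑ t : Fin k, KvFree S hk aV mV t p q) Ko Φ A Ψ| ≤
      (∏ i, lineConst G Po (P.mesh k) C₀ Co (eL i)) *
        (|Mh.C.e| ^ (∑ v, (G.kind v).dv) * |Mh.lamRun| ^ (∑ v, (G.kind v).ds) * Real.exp (-(δ₀ * torusTreeLen k y)) *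
          (∏ v, (N : ℝ) ^ 2 * vConst (B v) (G.kind v)) * ∏ v, NE v) *
        ∑ σ : Equiv.Perm (Fin m),
          (orderedModel G Po eL σ (fun v => ((extraEta (G.kind v) : ℤ) : ℝ)) (lineDim G Po P.d ao) P.d P.L δ₀ P.hd hL2 hδ).const215 := by
  obtain ⟨δ₁, C₀, hδ₁, hC₀, h⟩ := abs_graphAmp_le_prop21_zero (nbar := nbar) d L hd hL haS hmS haV hmV
  refine ⟨δ₁, C₀, hδ₁, hC₀, ?_⟩
  intro P _ S hPd hPL k hk hk1 hmesh hL2 N Mh hB G hn hG dm2 loc B Po m Ko Φ A Ψ eL δ₀ hδ hδδ ao Co hCo hKo nS hnS0 hΦ nV hnV0 hA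
    nO hnO0 hΨ NE hNE y hloc p D hy hD conn hpos
  have hLpos : 0 < P.L := P.hL
  -- the (1.18) kernel as a scale family concentrated at the top index `k − 1`
  let KoT : ℕ → Po.Line oRank → HiggsLattice.Site P k × Fin N → HiggsLattice.Site P k × Fin N → ℝ :=
    fun t l r r' => if t = k - 1 then Ko l r r' else 0
  have hsum : (fun l r r' => ∑ t : Fin k, KoT t l r r') = Ko := by
    funext l r r'
    have hk' : k - 1 < k := by omega
    rw [Finset.sum_eq_single (⟨k - 1, hk'⟩ : Fin k)]
    · simp [KoT]
    · intro t _ ht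
      have : (t : ℕ) ≠ k - 1 := fun h' => ht (Fin.ext h')
      simp [KoT, this]
    · intro h'
      exact absurd (Finset.mem_univ _) h'
  have hKoT : ∀ t, t < k → ∀ (l : Po.Line oRank) (ξ₁ ξ₂ : Lab P N),
      |∑ r, ∑ r', sigOK k (G.kind l.1.1) l.1.2 ξ₁ r * sigOK k (G.kind (Po.mate l.1).1) (Po.mate l.1).2 ξ₂ r' * KoT t l r r'| ≤
        torusKer P.L k δ₀ (Co l) (ao l) t ξ₁.pos ξ₂.pos := by
    intro t _ l ξ₁ ξ₂
    by_cases ht : t = k - 1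
    · subst ht
      simpa [KoT] using hKo l ξ₁ ξ₂
    · simp only [KoT, if_neg ht, mul_zero, Finset.sum_const_zero, abs_zero]
      exact torusKer_nonneg hLpos k δ₀ (hCo l) _ t _ _
  have h1 := h P S hPd hPL k hk hk1 hmesh hL2 N Mh hB G hn hG dm2 loc B Po KoT Φ A Ψ eL δ₀ hδ hδδ ao Co hCo hKoT nS hnS0 hΦ nV
    hnV0 hA nO hnO0 hΨ NE hNE y hloc p D hy hD conn hpos
  rw [hsum] at h1
  exact h1

end Prop21

/-! ## §4 The summed free kernels ARE the entries of the tree's zero-background propagators (up to `η^d(L^kε)²`); the corollary -/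

section ModelKernels

variable {P : HiggsLattice.Params} {N k : ℕ} (S : Shape P) (hk : k ≤ P.K)

/-- **(2.6) IN THE EVALUATOR'S CURRENCY, scalar lines**: the sum of the free scalar line kernels of all scale indices is the matrix entry of
the model's zero-background propagator `G^ε_k(T_ε, 0)` (the tree's `HiggsCovariance.propagatorK C T_ε 0 m² a k`, any charge data `C`) on
FILE 2's basis fields, divided by `η^d(L^kε)²` (`η = L^{−k}` the spacing of p14's level-`k` torus; FILE 16's `opEntry_propagatorK_zero_pieces`
+ `gpieceH_eq`): `Σ_{j<k} KsFree_j((x,i),(x′,i′)) = (η^d(L^kε)²)^{−1}·opEntry (G^ε_k(T_ε,0)) ((x,i),(x′,i′))`.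
[cite: Balaban1983Higgs3, (2.6) p.424] [cite: Balaban1982Higgs1, (2.20) p.610] -/
theorem sum_KsFree_eq (C : ChargeData N) {a m2 : ℝ} (ha : 0 < a) (hm2 : 0 ≤ m2) (hk1 : 1 ≤ k)
    (p p' : HiggsLattice.Site P 0 × Fin N) :
    ∑ t : Fin k, KsFree S hk a m2 t p p' =
      (((setupAt S k).eps ^ P.d)⁻¹ * (P.mesh k ^ 2)⁻¹) *
        opEntry (propagatorK C Finset.univ (0 : HiggsLattice.VecField P 0) m2 a k) p p' := by
  rw [opEntry_propagatorK_zero_pieces S hk C hk1 ha hm2]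
  unfold KsFree
  by_cases h : p.2 = p'.2
  · simp only [h, if_true, gpieceH_eq]
    rw [← Finset.mul_sum, Fin.sum_univ_eq_sum_range (fun t => pieceH S hk a (m2 * P.mesh k ^ 2) t p.1 p'.1) k]
    have hm : P.mesh k ^ 2 ≠ 0 := pow_ne_zero _ (P.mesh_pos k).ne'
    rw [mul_assoc, inv_mul_cancel_left₀ hm]
  · simp [h]

/-- **(2.6) IN THE EVALUATOR'S CURRENCY, vector lines**: the sum of the free vector line kernels of all scale indices is FILE 2's
`bondEntry` of the tree's vector-field propagator `HiggsFluctMeasure.vecG` at zero background divided by `η^d(L^kε)²` (FILE 16's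
`bondEntry_vecG_zero_pieces`; *"and the similar equality for the vector field propagator"*). [cite: Balaban1983Higgs3, (2.6) p.424]
[cite: Balaban1982Higgs1, (2.20) p.610] -/
theorem sum_KvFree_eq {a m2 : ℝ} (ha : 0 < a) (hm2 : 0 ≤ m2) (hk1 : 1 ≤ k) (b b' : HiggsLattice.PBond P 0) :
    ∑ t : Fin k, KvFree S hk a m2 t b b' =
      (((setupAt S k).eps ^ P.d)⁻¹ * (P.mesh k ^ 2)⁻¹) * bondEntry (HiggsFluctMeasure.vecG P m2 a k) b b' := by
  rw [bondEntry_vecG_zero_pieces S hk hk1 ha hm2]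
  unfold KvFree
  by_cases h : b.dir = b'.dir
  · simp only [h, if_true, gpieceH_eq]
    rw [← Finset.mul_sum, Fin.sum_univ_eq_sum_range (fun t => pieceH S hk a (m2 * P.mesh k ^ 2) t b.src b'.src) k]
    have hm : P.mesh k ^ 2 ≠ 0 := pow_ne_zero _ (P.mesh_pos k).ne'
    rw [mul_assoc, inv_mul_cancel_left₀ hm]
  · simp [h]

/-- The normalization scalar `η^d(L^kε)²` lies in `(0, 1]` (`L ≧ 2`, `L^kε ≦ 1`). [cite: Balaban1982Higgs1, (2.20) p.610] -/
theorem norm_scalar_pos_le_one (hL2 : 2 ≤ P.L) (hmesh : P.mesh k ≤ 1) :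
    0 < (setupAt S k).eps ^ P.d * P.mesh k ^ 2 ∧ (setupAt S k).eps ^ P.d * P.mesh k ^ 2 ≤ 1 := by
  have hLr : (1 : ℝ) ≤ (P.L : ℝ) := by exact_mod_cast (le_trans (by norm_num) hL2)
  have heps : (setupAt S k).eps = ((P.L : ℝ)⁻¹) ^ k := rfl
  have heps0 : 0 < (setupAt S k).eps := by rw [heps]; positivity
  have heps1 : (setupAt S k).eps ≤ 1 := by
    rw [heps]
    exact pow_le_one₀ (inv_nonneg.2 (by positivity)) (inv_le_one_of_one_le₀ hLr)
  refine ⟨mul_pos (pow_pos heps0 _) (pow_pos (P.mesh_pos k) 2), ?_⟩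
  exact mul_le_one₀ (pow_le_one₀ heps0.le heps1) (sq_nonneg _) (pow_le_one₀ (P.mesh_pos k).le hmesh)

/-- **PROPOSITION 2.1 AT ZERO BACKGROUND FOR THE EXPRESSION WITH THE TREE'S PROPAGATORS ON ITS LINES** — every scalar line carrying the
entries of `G^ε_k(T_ε, 0)` (`opEntry (HiggsCovariance.propagatorK C T_ε 0 m²_S a_S k)`), every vector line the bond entries of
`HiggsFluctMeasure.vecG P m²_V a_V k`, the (1.18) pairs a supplied scale family as before: by §4's identification and §1's homogeneity this
expression is `(η^d(L^kε)²)^{#scalar lines + #vector lines}` times the expression of `abs_graphAmp_le_prop21_zero`, and that scalar is `≦ 1`,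
so the SAME `k`-uniform bound holds. [cite: Balaban1983Higgs3, Proposition 2.1 p.424] [cite: Balaban1983Higgs3, (1.33) p.420]
[cite: Balaban1983Higgs3, (2.6) p.424] [cite: Balaban1982Higgs1, (2.20) p.610] -/
theorem abs_graphAmp_model_le_prop21_zero {nbar : ℕ} (d L : ℕ) (hd : 1 ≤ d) (hL : Odd L ∧ 1 < L)
    {aS : ℝ} (haS : 0 < aS) {mS : ℝ} (hmS : 0 ≤ mS) {aV : ℝ} (haV : 0 < aV) {mV : ℝ} (hmV : 0 ≤ mV) :
    ∃ δ₁ C₀ : ℝ, 0 < δ₁ ∧ 0 < C₀ ∧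
    ∀ (P : HiggsLattice.Params) [DecidableEq (HiggsLattice.PBond P 0)] (S : Shape P), P.d = d → P.L = L →
    ∀ (k : ℕ) (hk : k ≤ P.K), 1 ≤ k → P.mesh k ≤ 1 → ∀ (hL2 : 2 ≤ P.L) (N : ℕ) (Mh : Model P N k), Mh.B = 0 →
    ∀ (C : ChargeData N) (G : Graph nbar), 1 ≤ nbar → (∀ v, (G.kind v).isAveragingVertex = false) →
    ∀ (dm2 : Fin G.nV → HiggsLattice.Site P 0 → ℝ) (loc : Fin G.nV → Loc P k) (B : ∀ v, DataBounds Mh (dm2 v) (loc v))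
      (Po : OutPairing G) {m : ℕ}
      (KoT : ℕ → Po.Line oRank → HiggsLattice.Site P k × Fin N → HiggsLattice.Site P k × Fin N → ℝ)
      (Φ : (ExtSLeg G → HiggsLattice.Site P 0 × Fin N) → ℝ) (A : (ExtVLeg G → HiggsLattice.PBond P 0) → ℝ)
      (Ψ : (Po.Ext → HiggsLattice.Site P k × Fin N) → ℝ)
      (eL : Fin m ≃ Lines G Po) (δ₀ : ℝ) (hδ : 0 < δ₀), δ₀ ≤ δ₁ →
    ∀ (ao : Po.Line oRank → ℝ) (Co : Po.Line oRank → ℝ), (∀ l, 0 ≤ Co l) →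
    (∀ t, t < k → ∀ (l : Po.Line oRank) (ξ₁ ξ₂ : Lab P N),
      |∑ r, ∑ r', sigOK k (G.kind l.1.1) l.1.2 ξ₁ r * sigOK k (G.kind (Po.mate l.1).1) (Po.mate l.1).2 ξ₂ r' * KoT t l r r'| ≤
        torusKer P.L k δ₀ (Co l) (ao l) t ξ₁.pos ξ₂.pos) →
    ∀ (nS : ExtSLeg G → HiggsLattice.Site P 0 → ℝ), (∀ e x, 0 ≤ nS e x) →
    (∀ ξ : Fin G.nV → Lab P N,
      |∑ γ : ExtSLeg G → HiggsLattice.Site P 0 × Fin N, (∏ e : ExtSLeg G, sigSK Mh (G.kind e.1.1) e.1.2 (ξ e.1.1) (γ e)) * Φ γ| ≤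
        ∏ e : ExtSLeg G, nS e (ξ e.1.1).pos) →
    ∀ (nV : ExtVLeg G → HiggsLattice.Site P 0 → ℝ), (∀ e x, 0 ≤ nV e x) →
    (∀ ξ : Fin G.nV → Lab P N,
      |∑ ζ : ExtVLeg G → HiggsLattice.PBond P 0, (∏ e : ExtVLeg G, sigVK Mh (G.kind e.1.1) e.1.2 (ξ e.1.1) (ζ e)) * A ζ| ≤
        ∏ e : ExtVLeg G, nV e (ξ e.1.1).pos) →
    ∀ (nO : Po.Ext → HiggsLattice.Site P 0 → ℝ), (∀ e x, 0 ≤ nO e x) →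
    (∀ ξ : Fin G.nV → Lab P N,
      |∑ ο : Po.Ext → HiggsLattice.Site P k × Fin N, (∏ e : Po.Ext, sigOK k (G.kind e.1.1) e.1.2 (ξ e.1.1) (ο e)) * Ψ ο| ≤
        ∏ e : Po.Ext, nO e (ξ e.1.1).pos) →
    ∀ (NE : Fin G.nV → ℝ), (∀ v x, |extAt Po nS nV nO v x| ≤ NE v) →
    ∀ (y : Fin G.nV → HiggsLattice.Site P k),
      (∀ v x, x ∉ blockK k (y v) → uOfKind Mh (dm2 v) (loc v) (G.kind v) x = 0) →
    ∀ (p : HiggsLattice.Site P k) (D : ℕ), (∀ v, HiggsLattice.Site.tdist (y v) p ≤ D) → (∀ μ, 2 * D < P.halfPerDir k μ) →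
    LinesConnect (fun i => lineSrc Po (eL i)) (fun i => lineTgt Po (eL i)) →
    PosDegAlong G Po eL (fun v => ((extraEta (G.kind v) : ℤ) : ℝ)) (lineDim G Po P.d ao) P.d P.L δ₀ P.hd hL2 hδ →
    |graphAmp G Mh dm2 loc Po (fun _ => opEntry (propagatorK C Finset.univ (0 : HiggsLattice.VecField P 0) mS aS k))
        (fun _ => bondEntry (HiggsFluctMeasure.vecG P mV aV k)) (fun l p q => ∑ t : Fin k, KoT t l p q) Φ A Ψ| ≤
      (∏ i, lineConst G Po (P.mesh k) C₀ Co (eL i)) *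
        (|Mh.C.e| ^ (∑ v, (G.kind v).dv) * |Mh.lamRun| ^ (∑ v, (G.kind v).ds) * Real.exp (-(δ₀ * torusTreeLen k y)) *
          (∏ v, (N : ℝ) ^ 2 * vConst (B v) (G.kind v)) * ∏ v, NE v) *
        ∑ σ : Equiv.Perm (Fin m),
          (orderedModel G Po eL σ (fun v => ((extraEta (G.kind v) : ℤ) : ℝ)) (lineDim G Po P.d ao) P.d P.L δ₀ P.hd hL2 hδ).const215 := by
  obtain ⟨δ₁, C₀, hδ₁, hC₀, h⟩ := abs_graphAmp_le_prop21_zero (nbar := nbar) d L hd hL haS hmS haV hmV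
  refine ⟨δ₁, C₀, hδ₁, hC₀, ?_⟩
  intro P _ S hPd hPL k hk hk1 hmesh hL2 N Mh hB C G hn hG dm2 loc B Po m KoT Φ A Ψ eL δ₀ hδ hδδ ao Co hCo hKo nS hnS0 hΦ nV hnV0
    hA nO hnO0 hΨ NE hNE y hloc p D hy hD conn hpos
  have h1 := h P S hPd hPL k hk hk1 hmesh hL2 N Mh hB G hn hG dm2 loc B Po KoT Φ A Ψ eL δ₀ hδ hδδ ao Co hCo hKo nS hnS0 hΦ nV
    hnV0 hA nO hnO0 hΨ NE hNE y hloc p D hy hD conn hpos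
  -- the normalization scalar per line
  obtain ⟨hc0, hc1⟩ := norm_scalar_pos_le_one S (k := k) hL2 hmesh
  set c : ℝ := (setupAt S k).eps ^ P.d * P.mesh k ^ 2 with hc
  have hcinv : (((setupAt S k).eps ^ P.d)⁻¹ * (P.mesh k ^ 2)⁻¹) = c⁻¹ := by rw [hc, mul_inv]
  have hKs : (fun _ : SLine G => opEntry (propagatorK C Finset.univ (0 : HiggsLattice.VecField P 0) mS aS k)) =
      fun (_ : SLine G) p q => c * ∑ t : Fin k, KsFree S hk aS mS t p q := by
    funext l p q
    rw [sum_KsFree_eq S hk C haS hmS hk1, hcinv, mul_inv_cancel_left₀ hc0.ne']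
  have hKv : (fun _ : VLine G => bondEntry (HiggsFluctMeasure.vecG P mV aV k)) =
      fun (_ : VLine G) p q => c * ∑ t : Fin k, KvFree S hk aV mV t p q := by
    funext l p q
    rw [sum_KvFree_eq S hk haV hmV hk1, hcinv, mul_inv_cancel_left₀ hc0.ne']
  rw [hKs, hKv, graphAmp_sLines_smul, graphAmp_vLines_smul, abs_mul, abs_mul, ← mul_assoc]
  have hcS : |∏ _l : SLine G, c| * |∏ _l : VLine G, c| ≤ 1 := by
    rw [abs_of_nonneg (Finset.prod_nonneg fun _ _ => hc0.le), abs_of_nonneg (Finset.prod_nonneg fun _ _ => hc0.le)]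
    exact mul_le_one₀ (Finset.prod_le_one (fun _ _ => hc0.le) fun _ _ => hc1) (Finset.prod_nonneg fun _ _ => hc0.le)
      (Finset.prod_le_one (fun _ _ => hc0.le) fun _ _ => hc1)
  have hrhs : 0 ≤ (∏ i, lineConst G Po (P.mesh k) C₀ Co (eL i)) *
      (|Mh.C.e| ^ (∑ v, (G.kind v).dv) * |Mh.lamRun| ^ (∑ v, (G.kind v).ds) * Real.exp (-(δ₀ * torusTreeLen k y)) *
        (∏ v, (N : ℝ) ^ 2 * vConst (B v) (G.kind v)) * ∏ v, NE v) *
      ∑ σ : Equiv.Perm (Fin m),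
        (orderedModel G Po eL σ (fun v => ((extraEta (G.kind v) : ℤ) : ℝ)) (lineDim G Po P.d ao) P.d P.L δ₀ P.hd hL2 hδ).const215 :=
    (abs_nonneg _).trans h1
  calc |∏ _l : SLine G, c| * |∏ _l : VLine G, c| *
        |graphAmp G Mh dm2 loc Po (fun _ p q => ∑ t : Fin k, KsFree S hk aS mS t p q)
          (fun _ p q => ∑ t : Fin k, KvFree S hk aV mV t p q) (fun l p q => ∑ t : Fin k, KoT t l p q) Φ A Ψ|
      ≤ 1 * ((∏ i, lineConst G Po (P.mesh k) C₀ Co (eL i)) *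
          (|Mh.C.e| ^ (∑ v, (G.kind v).dv) * |Mh.lamRun| ^ (∑ v, (G.kind v).ds) * Real.exp (-(δ₀ * torusTreeLen k y)) *
            (∏ v, (N : ℝ) ^ 2 * vConst (B v) (G.kind v)) * ∏ v, NE v) *
          ∑ σ : Equiv.Perm (Fin m),
            (orderedModel G Po eL σ (fun v => ((extraEta (G.kind v) : ℤ) : ℝ)) (lineDim G Po P.d ao) P.d P.L δ₀ P.hd hL2
              hδ).const215) :=
        mul_le_mul hcS h1 (abs_nonneg _) zero_le_one
    _ = _ := one_mul _

end ModelKernels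


/-! ## §5 The constant is UNIFORM in the graph for half-integral dimensions: `Σ_σ const215(σ) ≦ m!·unifConst215(d, L, m, 2δ₀)` -/

section UniformConst

variable {V : Type} [Fintype V] [DecidableEq V] {m : ℕ}

/-- **POSITIVE HALF-INTEGRAL DEGREES ARE `≧ ½`** (gen-2's degree `D = Σ_{v∈block}(d + e_v) − d + Σ_{lines} a_l` of (2.2) for a
generalized graph whose η-powers `e_v` and line dimensions `a_l` are half-integers; p19's `half_le_D_of_pos` for `Counts`, here for any
model of gen-2's class). [cite: Balaban1983Higgs3, (2.2) p.423] [cite: Balaban1983Higgs3, (2.14) p.427] -/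
theorem half_le_D_of_halfInt (M : B3Ineq215.Model V m) (he : ∀ v, ∃ z : ℤ, 2 * M.e v = z) (ha : ∀ l, ∃ z : ℤ, 2 * M.a l = z)
    {i : ℕ} {b : V} (h : 0 < M.D i b) : (1 / 2 : ℝ) ≤ M.D i b := by
  choose ze hze using he
  choose za hza using ha
  have h2 : ∃ Z : ℤ, 2 * M.D i b = Z := by
    refine ⟨(∑ v ∈ M.fiber i b, (2 * (M.d : ℤ) + ze v)) - 2 * M.d + ∑ l ∈ M.before i b, za l, ?_⟩
    unfold B3Ineq215.Model.D
    push_cast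
    have hC : ∑ v ∈ M.fiber i b, (2 * (M.d : ℝ) + (ze v : ℝ)) = 2 * ∑ v ∈ M.fiber i b, ((M.d : ℝ) + M.e v) := by
      rw [Finset.mul_sum]
      exact Finset.sum_congr rfl fun v _ => by rw [← hze v]; ring
    have hD : ∑ l ∈ M.before i b, (za l : ℝ) = 2 * ∑ l ∈ M.before i b, M.a l := by
      rw [Finset.mul_sum]
      exact Finset.sum_congr rfl fun l _ => by rw [← hza l]
    rw [hC, hD]
    ring
  obtain ⟨Z, hZ⟩ := h2
  have hz : (0 : ℝ) < (Z : ℝ) := by rw [← hZ]; linarith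
  have hz1 : (1 : ℤ) ≤ Z := by exact_mod_cast hz
  have : (1 : ℝ) ≤ (Z : ℝ) := by exact_mod_cast hz1
  linarith

/-- If every component of `G_{i+1}` has positive half-integral degree, then `Σ_α D(G_{i+1}^{(α)}) ≧ ½` (the component containing
`l(i+1)` contributes `≧ ½`, the others are positive; p19's `half_le_Dsum_succ` for any model). [cite: Balaban1983Higgs3, (2.16) p.428] -/
theorem half_le_Dsum_succ_halfInt (M : B3Ineq215.Model V m) (he : ∀ v, ∃ z : ℤ, 2 * M.e v = z) (ha : ∀ l, ∃ z : ℤ, 2 * M.a l = z)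
    {i : ℕ} (hi : i < m) (hpos : ∀ b ∈ M.reps (i + 1), M.Nontriv (i + 1) b → 0 < M.D (i + 1) b) :
    (1 / 2 : ℝ) ≤ M.Dsum (i + 1) := by
  unfold B3Ineq215.Model.Dsum
  have hbs : M.bs i hi ∈ (M.reps (i + 1)).filter (fun b => M.Nontriv (i + 1) b) :=
    mem_filter.2 ⟨M.bs_mem_reps_succ hi, M.nontriv_succ_bs hi⟩
  calc (1 / 2 : ℝ) ≤ M.D (i + 1) (M.bs i hi) :=
        half_le_D_of_halfInt M he ha (hpos _ (M.bs_mem_reps_succ hi) (M.nontriv_succ_bs hi))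
    _ ≤ ∑ b ∈ (M.reps (i + 1)).filter (fun b => M.Nontriv (i + 1) b), M.D (i + 1) b :=
        single_le_sum (f := fun b => M.D (i + 1) b) (fun b hb => (hpos b (mem_filter.1 hb).1 (mem_filter.1 hb).2).le) hbs

/-- **THE CONSTANT OF (2.15) IS UNIFORM IN THE GENERALIZED GRAPH** — for half-integral `e_v`, `a_l` and positive component degrees,
`const215 ≦ unifConst215(d, L, m, 2δ₀)` (p19's `B3Prop21Uniform.unifConst215`: `Π_{i<m} e^{δ₀}K(δ₀∕(2m+1)^{i+1}, d)·((1 − L^{−1∕2})^{−1})^m`,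
a function of `d`, `L`, `m`, `δ₀` only — print's *"O(1) depending on n̄ and δ₁ only"*; p19's `const215_le_unifConst215` for any model).
[cite: Balaban1983Higgs3, (2.15) p.427] -/
theorem const215_le_unifConst215_halfInt (M : B3Ineq215.Model V m) (he : ∀ v, ∃ z : ℤ, 2 * M.e v = z)
    (ha : ∀ l, ∃ z : ℤ, 2 * M.a l = z) (hpos : ∀ i, i ≤ m → ∀ b ∈ M.reps i, M.Nontriv i b → 0 < M.D i b) :
    M.const215 ≤ unifConst215 M.d M.L m (2 * M.δ₀) := by
  unfold B3Ineq215.Model.const215 unifConst215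
  have hK : ∏ i ∈ range m, M.Kst i =
      ∏ i ∈ range m, Real.exp (2 * M.δ₀ / 2) * B3Ineq215.Cube.Kdec (2 * M.δ₀ / 2 / (2 * m + 1) ^ (i + 1)) M.d := by
    refine Finset.prod_congr rfl fun i _ => ?_
    rw [mul_div_cancel_left₀ M.δ₀ two_ne_zero]
    rfl
  rw [hK]
  have hq : 0 < 1 - (M.L : ℝ) ^ (-(1 / 2 : ℝ)) := one_sub_rpow_neg_half_pos M.two_le_L
  have hKn : 0 ≤ ∏ i ∈ range m, Real.exp (2 * M.δ₀ / 2) * B3Ineq215.Cube.Kdec (2 * M.δ₀ / 2 / (2 * m + 1) ^ (i + 1)) M.d := by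
    rw [← hK]
    exact prod_nonneg fun i _ => (M.Kst_pos i).le
  refine mul_le_mul_of_nonneg_left ?_ hKn
  calc ∏ i ∈ range m, (1 - M.rho215 i)⁻¹
      ≤ ∏ _i ∈ range m, (1 - (M.L : ℝ) ^ (-(1 / 2 : ℝ)))⁻¹ := by
        refine prod_le_prod (fun i hi => ?_) (fun i hi => ?_)
        · have hi' : i < m := mem_range.1 hi
          have := M.rho215_lt_one (M.Dsum_succ_pos hi' (hpos (i + 1) hi'))
          exact inv_nonneg.2 (by linarith)
        · have hi' : i < m := mem_range.1 hi
          have hρ : M.rho215 i ≤ (M.L : ℝ) ^ (-(1 / 2 : ℝ)) := by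
            unfold B3Ineq215.Model.rho215
            exact Real.rpow_le_rpow_of_exponent_le M.one_lt_L.le
              (by linarith [half_le_Dsum_succ_halfInt M he ha hi' (hpos (i + 1) hi')])
          exact inv_anti₀ hq (by linarith)
    _ = ((1 - (M.L : ℝ) ^ (-(1 / 2 : ℝ)))⁻¹) ^ m := by rw [prod_const, card_range]

variable {nbar : ℕ} {P : HiggsLattice.Params} {N k : ℕ} [DecidableEq (HiggsLattice.PBond P 0)]

/-- **THE LINE DIMENSIONS OF FILE 21 ARE HALF-INTEGERS** (indeed integers: `2 − d − n_l`, `2 − d`) when the supplied output-pair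
dimensions `a_o` are. [cite: Balaban1983Higgs3, (2.14) p.427] -/
theorem lineDim_halfInt (G : Graph nbar) (Po : OutPairing G) (d : ℕ) {ao : Po.Line oRank → ℝ}
    (hao : ∀ l, ∃ z : ℤ, 2 * ao l = z) (l : Lines G Po) : ∃ z : ℤ, 2 * lineDim G Po d ao l = z := by
  rcases l with l | l | l
  · exact ⟨2 * (2 - (d : ℤ) - (nDiff G Po (Sum.inl l) : ℤ)), by simp [lineDim]⟩
  · exact ⟨2 * (2 - (d : ℤ)), by simp [lineDim]⟩
  · exact hao l

/-- **Σ_σ const215(σ) ≦ m!·unifConst215(d, L, m, 2δ₀) for the ordered models of FILE 21's generalized graph** (η-powers `extraEta ∈ ℤ`,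
line dimensions `lineDim`, half-integral `a_o`), under the degree hypothesis along every ordering — print's absorption of the `m!`
orderings into *"O(1) depending on n̄ only"* (p19's `sum_const215_le` for `Counts`). [cite: Balaban1983Higgs3, (2.7) p.425]
[cite: Balaban1983Higgs3, (2.15) p.427] -/
theorem sum_const215_orderedModel_le (G : Graph nbar) (Po : OutPairing G) {m : ℕ} (eL : Fin m ≃ Lines G Po) (d L : ℕ)
    {ao : Po.Line oRank → ℝ} (hao : ∀ l, ∃ z : ℤ, 2 * ao l = z) (δ₀ : ℝ) (hd : 0 < d) (hL : 2 ≤ L) (hδ : 0 < δ₀)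
    (hpos : PosDegAlong G Po eL (fun v => ((extraEta (G.kind v) : ℤ) : ℝ)) (lineDim G Po d ao) d L δ₀ hd hL hδ) :
    ∑ σ : Equiv.Perm (Fin m), (orderedModel G Po eL σ (fun v => ((extraEta (G.kind v) : ℤ) : ℝ)) (lineDim G Po d ao) d L δ₀ hd hL hδ).const215
      ≤ (m.factorial : ℝ) * unifConst215 d L m (2 * δ₀) := by
  have he : ∀ v : Fin G.nV, ∃ z : ℤ, 2 * (((extraEta (G.kind v) : ℤ) : ℝ)) = z :=
    fun v => ⟨2 * extraEta (G.kind v), by push_cast; ring⟩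
  calc ∑ σ : Equiv.Perm (Fin m),
        (orderedModel G Po eL σ (fun v => ((extraEta (G.kind v) : ℤ) : ℝ)) (lineDim G Po d ao) d L δ₀ hd hL hδ).const215
      ≤ ∑ _σ : Equiv.Perm (Fin m), unifConst215 d L m (2 * δ₀) :=
        sum_le_sum fun σ _ => const215_le_unifConst215_halfInt _ he (fun i => lineDim_halfInt G Po d hao (eL (σ i))) (hpos σ)
    _ = (m.factorial : ℝ) * unifConst215 d L m (2 * δ₀) := by
        rw [sum_const, card_univ, Fintype.card_perm, Fintype.card_fin, nsmul_eq_mul]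

/-- **PROPOSITION 2.1 AT ZERO BACKGROUND, THE CONSTANT A FUNCTION OF `d`, `L`, `m`, `δ₀` ONLY** — `abs_graphAmp_le_prop21_zero` with
`Σ_σ const215(σ)` majorized by `m!·unifConst215(d, L, m, 2δ₀)` (§5) for half-integral output-pair dimensions `a_o`: the printed form of
(1.33) for `G_ren = {G}`, *"O(1) … independent of ε, k"*, the dependence on the graph reduced to its number of lines `m` (print: *"The
maximal number of vertices depends in a simple way on n̄"*, p. 414). [cite: Balaban1983Higgs3, Proposition 2.1 p.424]
[cite: Balaban1983Higgs3, (1.33) p.420] [cite: Balaban1983Higgs3, (2.15) p.427] -/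
theorem abs_graphAmp_le_prop21_zero_unif {nbar : ℕ} (d L : ℕ) (hd : 1 ≤ d) (hL : Odd L ∧ 1 < L)
    {aS : ℝ} (haS : 0 < aS) {mS : ℝ} (hmS : 0 ≤ mS) {aV : ℝ} (haV : 0 < aV) {mV : ℝ} (hmV : 0 ≤ mV) :
    ∃ δ₁ C₀ : ℝ, 0 < δ₁ ∧ 0 < C₀ ∧
    ∀ (P : HiggsLattice.Params) [DecidableEq (HiggsLattice.PBond P 0)] (S : Shape P), P.d = d → P.L = L →
    ∀ (k : ℕ) (hk : k ≤ P.K), 1 ≤ k → P.mesh k ≤ 1 → ∀ (hL2 : 2 ≤ P.L) (N : ℕ) (Mh : Model P N k), Mh.B = 0 →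
    ∀ (G : Graph nbar), 1 ≤ nbar → (∀ v, (G.kind v).isAveragingVertex = false) →
    ∀ (dm2 : Fin G.nV → HiggsLattice.Site P 0 → ℝ) (loc : Fin G.nV → Loc P k) (B : ∀ v, DataBounds Mh (dm2 v) (loc v))
      (Po : OutPairing G) {m : ℕ}
      (KoT : ℕ → Po.Line oRank → HiggsLattice.Site P k × Fin N → HiggsLattice.Site P k × Fin N → ℝ)
      (Φ : (ExtSLeg G → HiggsLattice.Site P 0 × Fin N) → ℝ) (A : (ExtVLeg G → HiggsLattice.PBond P 0) → ℝ)
      (Ψ : (Po.Ext → HiggsLattice.Site P k × Fin N) → ℝ)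
      (eL : Fin m ≃ Lines G Po) (δ₀ : ℝ) (hδ : 0 < δ₀), δ₀ ≤ δ₁ →
    ∀ (ao : Po.Line oRank → ℝ), (∀ l, ∃ z : ℤ, 2 * ao l = z) → ∀ (Co : Po.Line oRank → ℝ), (∀ l, 0 ≤ Co l) →
    (∀ t, t < k → ∀ (l : Po.Line oRank) (ξ₁ ξ₂ : Lab P N),
      |∑ r, ∑ r', sigOK k (G.kind l.1.1) l.1.2 ξ₁ r * sigOK k (G.kind (Po.mate l.1).1) (Po.mate l.1).2 ξ₂ r' * KoT t l r r'| ≤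
        torusKer P.L k δ₀ (Co l) (ao l) t ξ₁.pos ξ₂.pos) →
    ∀ (nS : ExtSLeg G → HiggsLattice.Site P 0 → ℝ), (∀ e x, 0 ≤ nS e x) →
    (∀ ξ : Fin G.nV → Lab P N,
      |∑ γ : ExtSLeg G → HiggsLattice.Site P 0 × Fin N, (∏ e : ExtSLeg G, sigSK Mh (G.kind e.1.1) e.1.2 (ξ e.1.1) (γ e)) * Φ γ| ≤
        ∏ e : ExtSLeg G, nS e (ξ e.1.1).pos) →
    ∀ (nV : ExtVLeg G → HiggsLattice.Site P 0 → ℝ), (∀ e x, 0 ≤ nV e x) →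
    (∀ ξ : Fin G.nV → Lab P N,
      |∑ ζ : ExtVLeg G → HiggsLattice.PBond P 0, (∏ e : ExtVLeg G, sigVK Mh (G.kind e.1.1) e.1.2 (ξ e.1.1) (ζ e)) * A ζ| ≤
        ∏ e : ExtVLeg G, nV e (ξ e.1.1).pos) →
    ∀ (nO : Po.Ext → HiggsLattice.Site P 0 → ℝ), (∀ e x, 0 ≤ nO e x) →
    (∀ ξ : Fin G.nV → Lab P N,
      |∑ ο : Po.Ext → HiggsLattice.Site P k × Fin N, (∏ e : Po.Ext, sigOK k (G.kind e.1.1) e.1.2 (ξ e.1.1) (ο e)) * Ψ ο| ≤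
        ∏ e : Po.Ext, nO e (ξ e.1.1).pos) →
    ∀ (NE : Fin G.nV → ℝ), (∀ v x, |extAt Po nS nV nO v x| ≤ NE v) →
    ∀ (y : Fin G.nV → HiggsLattice.Site P k),
      (∀ v x, x ∉ blockK k (y v) → uOfKind Mh (dm2 v) (loc v) (G.kind v) x = 0) →
    ∀ (p : HiggsLattice.Site P k) (D : ℕ), (∀ v, HiggsLattice.Site.tdist (y v) p ≤ D) → (∀ μ, 2 * D < P.halfPerDir k μ) →
    LinesConnect (fun i => lineSrc Po (eL i)) (fun i => lineTgt Po (eL i)) →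
    PosDegAlong G Po eL (fun v => ((extraEta (G.kind v) : ℤ) : ℝ)) (lineDim G Po P.d ao) P.d P.L δ₀ P.hd hL2 hδ →
    |graphAmp G Mh dm2 loc Po (fun _ p q => ∑ t : Fin k, KsFree S hk aS mS t p q)
        (fun _ p q => ∑ t : Fin k, KvFree S hk aV mV t p q) (fun l p q => ∑ t : Fin k, KoT t l p q) Φ A Ψ| ≤
      (∏ i, lineConst G Po (P.mesh k) C₀ Co (eL i)) *
        (|Mh.C.e| ^ (∑ v, (G.kind v).dv) * |Mh.lamRun| ^ (∑ v, (G.kind v).ds) * Real.exp (-(δ₀ * torusTreeLen k y)) *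
          (∏ v, (N : ℝ) ^ 2 * vConst (B v) (G.kind v)) * ∏ v, NE v) *
        ((m.factorial : ℝ) * unifConst215 P.d P.L m (2 * δ₀)) := by
  obtain ⟨δ₁, C₀, hδ₁, hC₀, h⟩ := abs_graphAmp_le_prop21_zero (nbar := nbar) d L hd hL haS hmS haV hmV
  refine ⟨δ₁, C₀, hδ₁, hC₀, ?_⟩
  intro P _ S hPd hPL k hk hk1 hmesh hL2 N Mh hB G hn hG dm2 loc B Po m KoT Φ A Ψ eL δ₀ hδ hδδ ao hao Co hCo hKo nS hnS0 hΦ nV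
    hnV0 hA nO hnO0 hΨ NE hNE y hloc p D hy hD conn hpos
  refine (h P S hPd hPL k hk hk1 hmesh hL2 N Mh hB G hn hG dm2 loc B Po KoT Φ A Ψ eL δ₀ hδ hδδ ao Co hCo hKo nS hnS0 hΦ nV hnV0 hA
    nO hnO0 hΨ NE hNE y hloc p D hy hD conn hpos).trans ?_
  have hC : 0 ≤ ∏ i, lineConst G Po (P.mesh k) C₀ Co (eL i) :=
    Finset.prod_nonneg fun i _ => lineConst_nonneg G Po (P.mesh_pos k) hC₀.le hCo (eL i)
  have hΦn : 0 ≤ ∏ v, (N : ℝ) ^ 2 * vConst (B v) (G.kind v) := Finset.prod_nonneg fun v _ => nPhi_nonneg G Mh dm2 loc B v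
  have hNEn : 0 ≤ ∏ v, NE v := Finset.prod_nonneg fun v _ => NE_nonneg hNE v
  have hpre : 0 ≤ (∏ i, lineConst G Po (P.mesh k) C₀ Co (eL i)) *
      (|Mh.C.e| ^ (∑ v, (G.kind v).dv) * |Mh.lamRun| ^ (∑ v, (G.kind v).ds) * Real.exp (-(δ₀ * torusTreeLen k y)) *
        (∏ v, (N : ℝ) ^ 2 * vConst (B v) (G.kind v)) * ∏ v, NE v) :=
    mul_nonneg hC (mul_nonneg (mul_nonneg (mul_nonneg (mul_nonneg (pow_nonneg (abs_nonneg _) _) (pow_nonneg (abs_nonneg _) _))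
      (Real.exp_pos _).le) hΦn) hNEn)
  exact mul_le_mul_of_nonneg_left (sum_const215_orderedModel_le G Po eL P.d P.L hao δ₀ P.hd hL2 hδ hpos) hpre

end UniformConst


/-! ## §6 (v1.1) The (1.18) pairing kernel itself meets the top-scale hypothesis: the output pairs made hypothesis-free -/

section Pair118

open Literature.MathematicalPhysics.QuantumFieldTheory.Balaban1983to89.B1Cor23ZeroFieldRegion (tdist_le_of_blockIter_eq_real)
open Literature.MathematicalPhysics.QuantumFieldTheory.Balaban1983to89.HiggsAveraging (blockIter)

variable {P : HiggsLattice.Params} {N k : ℕ}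

/-- kernel: `L^{k−1}·(L^k)^{−1} = L^{−1}` for `k ≧ 1`, `L ≠ 0`. [folklore] -/
private theorem pow_pred_mul_inv_pow {L : ℝ} (hL : L ≠ 0) {k : ℕ} (hk : 1 ≤ k) : L ^ (k - 1) * (L ^ k)⁻¹ = L⁻¹ := by
  obtain ⟨j, rfl⟩ : ∃ j, k = j + 1 := ⟨k - 1, by omega⟩
  rw [Nat.add_sub_cancel, pow_succ, mul_inv, ← mul_assoc, mul_inv_cancel₀ (pow_ne_zero _ hL), one_mul]

/-- **THE (1.18) PAIRING KERNEL IS DOMINATED BY THE TORUS SHAPE AT THE TOP SCALE INDEX `k − 1`**: FILE 2's `pairKernel a` (`−a·δ` at a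
common block point and channel; print: *"taking a scalar product of two expressions from (1.12)–(1.15) and multiplying it by −a_k, or
−½a_k if they are equal"*) has block-point entries `|pairKernel a ((x^{(k)},c),(x′^{(k)},c′))| ≦ |a|·[x^{(k)} = x′^{(k)}]`, and two fine
sites of one `k`-block are at torus distance `≦ L^k − 1` (`tdist_le_of_blockIter_eq_real`), so that `η·|x − x′|_T < 1` and the torus
shape `C·(L^{k−1}η)^{a_o}·exp[−2δ₀(L^{k−1}η)^{−1}η|x − x′|_T]` with `C = |a|·e^{2δ₀L}·L^{a_o}` is `≧ |a|` there (`L^{k−1}η = L^{−1}`).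
[cite: Balaban1983Higgs3, (1.18) p.415] [cite: Balaban1982Higgs1, (1.20) p.607] -/
theorem abs_pairKernel_le_torusKer_top (hk : k ≤ P.K) (hk1 : 1 ≤ k) (a : ℝ) {δ₀ : ℝ} (hδ : 0 ≤ δ₀) (ao : ℝ)
    (x : HiggsLattice.Site P 0) (c : Fin N) (x' : HiggsLattice.Site P 0) (c' : Fin N) :
    |pairKernel a (blockIter k x, c) (blockIter k x', c')| ≤
      torusKer P.L k δ₀ (|a| * Real.exp (2 * δ₀ * P.L) * (P.L : ℝ) ^ ao) ao (k - 1) x x' := by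
  have hLpos : 0 < P.L := P.hL
  have hLr : (0 : ℝ) < (P.L : ℝ) := by exact_mod_cast hLpos
  have hC : 0 ≤ |a| * Real.exp (2 * δ₀ * P.L) * (P.L : ℝ) ^ ao :=
    mul_nonneg (mul_nonneg (abs_nonneg _) (Real.exp_pos _).le) (Real.rpow_nonneg hLr.le _)
  by_cases h : ((blockIter k x, c) : HiggsLattice.Site P k × Fin N) = (blockIter k x', c')
  · -- same block point and channel: the entry is `−a`, the shape is `≥ |a|`
    have hblk : blockIter k x = blockIter k x' := (Prod.mk.inj h).1
    have hent : |pairKernel a (blockIter k x, c) (blockIter k x', c')| = |a| := by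
      rw [pairKernel, if_pos h, abs_neg]
    rw [hent]
    unfold torusKer
    have hs : (P.L : ℝ) ^ (k - 1) * ((P.L : ℝ) ^ k)⁻¹ = (P.L : ℝ)⁻¹ := pow_pred_mul_inv_pow hLr.ne' hk1
    rw [hs]
    -- `L^{ao}·(L^{−1})^{ao} = 1`
    have hpow : (P.L : ℝ) ^ ao * ((P.L : ℝ)⁻¹) ^ ao = 1 := by
      rw [Real.inv_rpow hLr.le, mul_inv_cancel₀ (Real.rpow_pos_of_pos hLr _).ne']
    -- the exponential factor is `≥ e^{−2δ₀L}` since `η·tdist ≤ (L^k − 1)/L^k ≤ 1`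
    have htd : ((P.L : ℝ) ^ k)⁻¹ * (HiggsLattice.Site.tdist x x' : ℝ) ≤ 1 := by
      have h1 := tdist_le_of_blockIter_eq_real hk hblk
      have hLk : (0 : ℝ) < (P.L : ℝ) ^ k := pow_pos hLr _
      rw [inv_mul_le_iff₀ hLk, mul_one]
      linarith
    have hexp : Real.exp (-(2 * δ₀ * P.L)) ≤
        Real.exp (-(2 * δ₀ / (P.L : ℝ)⁻¹ * (((P.L : ℝ) ^ k)⁻¹ * (HiggsLattice.Site.tdist x x' : ℝ)))) := by
      apply Real.exp_le_exp.2
      rw [div_inv_eq_mul]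
      have h0 : 0 ≤ 2 * δ₀ * (P.L : ℝ) := by positivity
      nlinarith [mul_le_mul_of_nonneg_left htd h0]
    calc |a| = |a| * Real.exp (2 * δ₀ * P.L) * ((P.L : ℝ) ^ ao * ((P.L : ℝ)⁻¹) ^ ao) * Real.exp (-(2 * δ₀ * P.L)) := by
          rw [hpow, mul_one, mul_assoc, ← Real.exp_add, add_neg_cancel, Real.exp_zero, mul_one]
      _ ≤ |a| * Real.exp (2 * δ₀ * P.L) * ((P.L : ℝ) ^ ao * ((P.L : ℝ)⁻¹) ^ ao) *
            Real.exp (-(2 * δ₀ / (P.L : ℝ)⁻¹ * (((P.L : ℝ) ^ k)⁻¹ * (HiggsLattice.Site.tdist x x' : ℝ)))) :=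
          mul_le_mul_of_nonneg_left hexp (by rw [hpow, mul_one]; exact mul_nonneg (abs_nonneg _) (Real.exp_pos _).le)
      _ = |a| * Real.exp (2 * δ₀ * P.L) * (P.L : ℝ) ^ ao * ((P.L : ℝ)⁻¹) ^ ao *
            Real.exp (-(2 * δ₀ / (P.L : ℝ)⁻¹ * (((P.L : ℝ) ^ k)⁻¹ * (HiggsLattice.Site.tdist x x' : ℝ)))) := by ring
  · rw [pairKernel, if_neg h, abs_zero]
    exact torusKer_nonneg hLpos k δ₀ hC ao (k - 1) x x'

/-- **FILE 21's ∕ §3's OUTPUT-PAIR HYPOTHESIS AT THE TOP SCALE INDEX, DISCHARGED FOR THE (1.18) KERNEL**: the contraction of `pairKernel a`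
against the output attachments of any two labels is dominated by the torus shape at scale index `k − 1` with constant
`|a|·e^{2δ₀L}·L^{a_o}` (FILE 19's `abs_sum2_sigOK_le` with the entry bound above). [cite: Balaban1983Higgs3, (1.18) p.415] -/
theorem abs_sum2_sigOK_pairKernel_le_top (hk : k ≤ P.K) (hk1 : 1 ≤ k) (a : ℝ) {δ₀ : ℝ} (hδ : 0 ≤ δ₀) (ao : ℝ)
    (κ₁ κ₂ : VertexKind) (j₁ : Fin (outSlots κ₁)) (j₂ : Fin (outSlots κ₂)) (ξ₁ ξ₂ : Lab P N) :
    |∑ r, ∑ r', sigOK k κ₁ j₁ ξ₁ r * sigOK k κ₂ j₂ ξ₂ r' * pairKernel a r r'| ≤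
      torusKer P.L k δ₀ (|a| * Real.exp (2 * δ₀ * P.L) * (P.L : ℝ) ^ ao) ao (k - 1) ξ₁.pos ξ₂.pos :=
  abs_sum2_sigOK_le (pairKernel a) (fun x x' => torusKer P.L k δ₀ (|a| * Real.exp (2 * δ₀ * P.L) * (P.L : ℝ) ^ ao) ao (k - 1) x x')
    (fun x x' => torusKer_nonneg P.hL k δ₀
      (mul_nonneg (mul_nonneg (abs_nonneg _) (Real.exp_pos _).le) (Real.rpow_nonneg (Nat.cast_nonneg _) _)) ao (k - 1) x x')
    (fun x c x' c' => abs_pairKernel_le_torusKer_top hk hk1 a hδ ao x c x' c') κ₁ κ₂ j₁ j₂ ξ₁ ξ₂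

variable [DecidableEq (HiggsLattice.PBond P 0)]

/-- **PROPOSITION 2.1 AT ZERO BACKGROUND WITH THE (1.18) PAIRS AS PRINTED** — the output pairs carrying FILE 2's `pairKernel (κ_o l)`
(coefficient `κ_o(l) = a_k`, or `½a_k` *"if they are equal"*, supplied per pair) need NO hypothesis: `abs_graphAmp_le_prop21_zero_pairTop`
with the top-scale domination of §6 (`abs_sum2_sigOK_pairKernel_le_top`), output-pair constants `C_o(l) = |κ_o(l)|·e^{2δ₀L}·L^{a_o(l)}` and
any supplied dimensions `a_o`. [cite: Balaban1983Higgs3, Proposition 2.1 p.424] [cite: Balaban1983Higgs3, (1.18) p.415]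
[cite: Balaban1983Higgs3, (2.13) p.426] -/
theorem abs_graphAmp_le_prop21_zero_pair118 {nbar : ℕ} (d L : ℕ) (hd : 1 ≤ d) (hL : Odd L ∧ 1 < L)
    {aS : ℝ} (haS : 0 < aS) {mS : ℝ} (hmS : 0 ≤ mS) {aV : ℝ} (haV : 0 < aV) {mV : ℝ} (hmV : 0 ≤ mV) :
    ∃ δ₁ C₀ : ℝ, 0 < δ₁ ∧ 0 < C₀ ∧
    ∀ (P : HiggsLattice.Params) [DecidableEq (HiggsLattice.PBond P 0)] (S : Shape P), P.d = d → P.L = L →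
    ∀ (k : ℕ) (hk : k ≤ P.K), 1 ≤ k → P.mesh k ≤ 1 → ∀ (hL2 : 2 ≤ P.L) (N : ℕ) (Mh : Model P N k), Mh.B = 0 →
    ∀ (G : Graph nbar), 1 ≤ nbar → (∀ v, (G.kind v).isAveragingVertex = false) →
    ∀ (dm2 : Fin G.nV → HiggsLattice.Site P 0 → ℝ) (loc : Fin G.nV → Loc P k) (B : ∀ v, DataBounds Mh (dm2 v) (loc v))
      (Po : OutPairing G) {m : ℕ} (κo : Po.Line oRank → ℝ)
      (Φ : (ExtSLeg G → HiggsLattice.Site P 0 × Fin N) → ℝ) (A : (ExtVLeg G → HiggsLattice.PBond P 0) → ℝ)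
      (Ψ : (Po.Ext → HiggsLattice.Site P k × Fin N) → ℝ)
      (eL : Fin m ≃ Lines G Po) (δ₀ : ℝ) (hδ : 0 < δ₀), δ₀ ≤ δ₁ →
    ∀ (ao : Po.Line oRank → ℝ)
      (nS : ExtSLeg G → HiggsLattice.Site P 0 → ℝ), (∀ e x, 0 ≤ nS e x) →
    (∀ ξ : Fin G.nV → Lab P N,
      |∑ γ : ExtSLeg G → HiggsLattice.Site P 0 × Fin N, (∏ e : ExtSLeg G, sigSK Mh (G.kind e.1.1) e.1.2 (ξ e.1.1) (γ e)) * Φ γ| ≤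
        ∏ e : ExtSLeg G, nS e (ξ e.1.1).pos) →
    ∀ (nV : ExtVLeg G → HiggsLattice.Site P 0 → ℝ), (∀ e x, 0 ≤ nV e x) →
    (∀ ξ : Fin G.nV → Lab P N,
      |∑ ζ : ExtVLeg G → HiggsLattice.PBond P 0, (∏ e : ExtVLeg G, sigVK Mh (G.kind e.1.1) e.1.2 (ξ e.1.1) (ζ e)) * A ζ| ≤
        ∏ e : ExtVLeg G, nV e (ξ e.1.1).pos) →
    ∀ (nO : Po.Ext → HiggsLattice.Site P 0 → ℝ), (∀ e x, 0 ≤ nO e x) →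
    (∀ ξ : Fin G.nV → Lab P N,
      |∑ ο : Po.Ext → HiggsLattice.Site P k × Fin N, (∏ e : Po.Ext, sigOK k (G.kind e.1.1) e.1.2 (ξ e.1.1) (ο e)) * Ψ ο| ≤
        ∏ e : Po.Ext, nO e (ξ e.1.1).pos) →
    ∀ (NE : Fin G.nV → ℝ), (∀ v x, |extAt Po nS nV nO v x| ≤ NE v) →
    ∀ (y : Fin G.nV → HiggsLattice.Site P k),
      (∀ v x, x ∉ blockK k (y v) → uOfKind Mh (dm2 v) (loc v) (G.kind v) x = 0) →
    ∀ (p : HiggsLattice.Site P k) (D : ℕ), (∀ v, HiggsLattice.Site.tdist (y v) p ≤ D) → (∀ μ, 2 * D < P.halfPerDir k μ) →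
    LinesConnect (fun i => lineSrc Po (eL i)) (fun i => lineTgt Po (eL i)) →
    PosDegAlong G Po eL (fun v => ((extraEta (G.kind v) : ℤ) : ℝ)) (lineDim G Po P.d ao) P.d P.L δ₀ P.hd hL2 hδ →
    |graphAmp G Mh dm2 loc Po (fun _ p q => ∑ t : Fin k, KsFree S hk aS mS t p q)
        (fun _ p q => ∑ t : Fin k, KvFree S hk aV mV t p q) (fun l => pairKernel (κo l)) Φ A Ψ| ≤
      (∏ i, lineConst G Po (P.mesh k) C₀ (fun l => |κo l| * Real.exp (2 * δ₀ * P.L) * (P.L : ℝ) ^ ao l) (eL i)) *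
        (|Mh.C.e| ^ (∑ v, (G.kind v).dv) * |Mh.lamRun| ^ (∑ v, (G.kind v).ds) * Real.exp (-(δ₀ * torusTreeLen k y)) *
          (∏ v, (N : ℝ) ^ 2 * vConst (B v) (G.kind v)) * ∏ v, NE v) *
        ∑ σ : Equiv.Perm (Fin m),
          (orderedModel G Po eL σ (fun v => ((extraEta (G.kind v) : ℤ) : ℝ)) (lineDim G Po P.d ao) P.d P.L δ₀ P.hd hL2 hδ).const215 := by
  obtain ⟨δ₁, C₀, hδ₁, hC₀, h⟩ := abs_graphAmp_le_prop21_zero_pairTop (nbar := nbar) d L hd hL haS hmS haV hmV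
  refine ⟨δ₁, C₀, hδ₁, hC₀, ?_⟩
  intro P _ S hPd hPL k hk hk1 hmesh hL2 N Mh hB G hn hG dm2 loc B Po m κo Φ A Ψ eL δ₀ hδ hδδ ao nS hnS0 hΦ nV hnV0 hA nO hnO0 hΨ
    NE hNE y hloc p D hy hD conn hpos
  exact h P S hPd hPL k hk hk1 hmesh hL2 N Mh hB G hn hG dm2 loc B Po (fun l => pairKernel (κo l)) Φ A Ψ eL δ₀ hδ hδδ ao
    (fun l => |κo l| * Real.exp (2 * δ₀ * P.L) * (P.L : ℝ) ^ ao l)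
    (fun l => mul_nonneg (mul_nonneg (abs_nonneg _) (Real.exp_pos _).le) (Real.rpow_nonneg (Nat.cast_nonneg _) _))
    (fun l ξ₁ ξ₂ => abs_sum2_sigOK_pairKernel_le_top hk hk1 (κo l) hδ.le (ao l) _ _ _ _ ξ₁ ξ₂)
    nS hnS0 hΦ nV hnV0 hA nO hnO0 hΨ NE hNE y hloc p D hy hD conn hpos

end Pair118

end

end Literature.MathematicalPhysics.QuantumFieldTheory.Balaban1983to89.B3Prop21ZeroBackground
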